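import Summits.AtomisticToContinuum.Crystallization.Theses.PricedLinkCensus
import Literature.MathematicalPhysics.StatisticalMechanics.LennardJonesClusters
import Literature.MathematicalPhysics.StatisticalMechanics.PeriodicConfigurationSums
import Literature.MathematicalPhysics.StatisticalMechanics.CrystallizationSymmetries
import Literature.Barriers.AtomisticToContinuum.SutoDegenerateGroundStates
import Literature.MathematicalPhysics.StatisticalMechanics.StablePotentialsProofs
import Literature.MathematicalPhysics.StatisticalMechanics.LennardJonesThermodynamicLimitProofs
import Summits.AtomisticToContinuum.Crystallization.Theorems.ChargedEnergyGap.Negative.PeriodicMinimisers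
import Summits.AtomisticToContinuum.Crystallization.Theorems.ChargedEnergyGap.Negative.BarlowBlind

/-!
# Disproof of `ChargedEnergyGap` (item stmt-AtomisticToContinuum-14231) — work file, generation 3

Standing adversary (`cdisprove`, refuter lineage) on the crux
`PricedLinkCensus.ChargedEnergyGap`:
`∃ κ > 0, ∃ C, ∀ N, ∀ injective y : Fin N → ℝ³, N·e* + κ·#charged(1/100, y) − C·N^(2/3) ≤ E_LJ(y)`,
`e* = ⨅_Q e_LJ(Q)` over periodic configurations, `#charged` = sites that are not charge-free
(12 bonds, all ring numbers 4) in the scale-free bond graph at tolerance `1/100`.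

VERDICT (cycle 3, gen 3): **resists**; no kill.  Everything below is `sorry`-free (no `sorry` in the file).
NEW IN CYCLE 3 (§9, and the landed parts VIII `PeriodicMinimisers` / IX `BarlowBlind`): the crux is the
strict positivity of ONE variational constant, `ChargedEnergyGap ↔ 0 < κ_max(1/100)` with
`κ_max(η) = ⨅ (E_LJ(y) − N·e*)/#charged_η(y)` over charged finite injective `y` and
`GapWith η (κ_max η) 0` UNCONDITIONALLY; what the crux forces on periodic configurations (every
periodic ground state charge-free at every point, charged fraction `≤ (e(Q) − e*)/κ`, the fully
charged periodic class uniformly gapped `e ≥ e* + κ`) with three kill criteria stated over periodic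
configurations only; and BLINDNESS: the pricing is vacuous on the entire ideal Barlow family (every
Hägg stacking, every scale, every `0 ≤ η < √2 − 1` is charge-free everywhere — first certified
inhabitants of `IsChargeFree`), so the crux can decide neither stacking nor density.

LANDED COMPANIONS (importable, namespace `…Theorems.ChargedEnergyGapNegative`, directory
`Theorems/ChargedEnergyGap/Negative/`): `FarCopies` (§0–§2) · `NoBoundaryReduction` (§3, §3b) ·
`Periodisation` (§4–§5) · `Tolerance` (§6) · `PeriodicForm` (§8) · `BlocksEnergy`, `BlocksTails`,
`BlocksBound` (blocks of a periodic configuration: exact energy identity, tails `o(K³)`; PROVE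
`bddBelow_energyPerParticle_lennardJones` = the statement of item 0714, `exists_trialState`,
`limsup_div_le_energyPerParticle` ⇒ item 11865 `CrysEnergyUpper` by `le_ciInf`) ·
`Unconditional` (p72123: `card_mul_eStar_le`, `chargedEnergyGap_iff_price`,
`not_gapWith_of_eta_nonpos'`, `crysEnergyLimit` = the statement of item 0626) · `BlocksLocal`,
`PeriodicFormConverse` (p72833 / p73175: crux ⇔ periodic pricing) · **gen 3:** `PeriodicMinimisers`
(VIII, p74751: `kappaMax`, periodic consequences, kill criteria) · `BarlowBlind` (IX, p74754:
`isChargeFree_barlowStacking`, `motifCharged_idealBarlowQ_eq_zero`, `periodicPricing_at_idealBarlowQ`).  Hence the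
conditionals "granted 0714" / "given CrysEnergyUpper" in §4 and §6 below are DISCHARGED there
(this work file stays self-contained).  One-line closers for 0714 / 11865 / 0626 are attached as
evidence (`Closers.lean`) for a prover to land.

## Findings (Lean-certified in this file)

* §0 `chargedEnergyGap_iff` — the crux is `∃ κ > 0, ∃ C, GapWith (1/100) κ C` (`Iff.rfl`);
  `GapWith η κ C` / `NoBoundary η κ` parametrise tolerance, price and boundary allowance.
* §1 `not_isChargeFree_of_card_le`, `charged_eq_of_le` — with `≤ 12` sites every site is charged.
* §2 far translated copies (`copies`, `copiesFin`, spacing `L = 8D + 8`): energy is at most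
  `M·E(y)` (`interactionEnergy_copiesFin_le`, cross terms `V_LJ ≤ 0` beyond distance `1`), the
  bond graph is the disjoint union of the copies' (`bondGraph_copies_adj`, needs only `η ≤ 1`),
  so charge-freeness transfers (`isChargeFree_copies_iff`) and `#charged` is multiplied by `M`
  (`charged_copiesFin`).
* §3 **LOAD-BEARING ANALYSIS OF THE ALLOWANCE `C`**: `noBoundary_of_gapWith` /
  `chargedEnergyGap_iff_noBoundary` — `ChargedEnergyGap ↔ ∃ κ > 0, ∀ N y, N·e* + κ·#charged ≤ E(y)`:
  the term `−C·N^(2/3)` is NOT load-bearing (amplify any violation by `m³` far copies).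
  Corollaries: `eStar_add_le_of_gapWith` (dimer: `e* + κ ≤ −1/24`), `kappa_le_of_gapWith`
  (certified ceiling `κ ≤ −1/24 − e*`), `eStar_lt_of_chargedEnergyGap`,
  **`bddBelow_of_chargedEnergyGap`** — the crux IMPLIES item 0714 `CrysPeriodicBddBelow`
  (not listed among its deps: with `¬ 0714` the `⨅` is the junk `0` and the dimer gas refutes the
  crux), `gapWith_mono`, and the KILL CRITERIA `not_gapWith_of_witness` (one injective `y` with
  `E(y) < N·e* + κ·#charged(y)` kills price `κ` for every `C`) and
  `not_chargedEnergyGap_of_cheap_charge` (such a `y_κ` for every `κ > 0` kills the crux).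

* §3b `chargedEnergyGap_iff_exp` — the exponent `2/3` is immaterial: for every `α < 1` the
  allowance `C·N^α` gives the same statement (`noBoundary_of_gapWithExp`, `M^(α−1) → 0`).
* §4 **THE `κ = 0` HALF IS ELEMENTARY**: `card_mul_eStar_le_interactionEnergy` — given 0714,
  `N·e* ≤ E_LJ(y)` for EVERY finite injective `y` (periodise `y` with the cubic lattice
  `Lℤ³`, `L = 2Σ‖yᵢ‖ + 2`; images interact with `V_LJ ≤ 0`); `gapWith_zero_zero_iff`
  (`GapWith η 0 0 ↔ 0714`); `chargedEnergyGap_iff_pricing` (crux ↔ 0714 ∧ a uniform price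
  `κ > 0` per charged site on the excess `E(y) − N·e* ≥ 0`); `nearMinimiser_of_violation`
  (a witness against price `κ` is a near-minimiser: `0 ≤ excess < κ·#charged ≤ κN`).
* §5 SHAPE: `gapWith_linear_allowance` — with allowance `C·N` instead of `C·N^(2/3)` the
  statement is trivially TRUE (unconditionally; finite stability `E ≥ −(2³²/12)N`), so all
  content sits in the sublinear allowance, i.e. (§3) in none; `not_gapNonInj` — WITHOUT
  `Function.Injective y` it is FALSE for every `η, κ, C` (pile-up `pile k`, energy `−k²/12`,
  `V_LJ(0) = 0` junk): injectivity, the only hypothesis on `y`, is load-bearing.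

* §6 **THE TOLERANCE IS LOAD-BEARING**: `not_gapWith_of_eta_nonpos` — with `η ≤ 0` in place of
  `1/100` the priced gap is FALSE for every `κ > 0`, `C`, given the route's own support item
  `CrysEnergyUpper` (11865) via `trialStates_of_crysEnergyUpper` (finite configurations approach
  `e*` from above).  `η < 0`: no bonds exist (`not_adj_of_eta_neg`), every site is charged
  (`charged_eq_of_eta_neg`).  `η = 0`: a bond at `i` has length exactly `nn_i`, so a
  configuration whose distances from each site are pairwise distinct is fully charged
  (`charged_eq_of_distinct`), and EVERY injective `y` has such a perturbation `yᵢ + t·4ⁱ·e₀`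
  at arbitrarily small energy cost (`exists_pert`: bad `t` are zeros of finitely many genuine
  quadratics, `wt_sq_sub_ne`/`four_pow_add_ne`, plus finitely many collisions; energy is
  continuous in `t`, `tendsto_energy_pert`).  Any proof must use `η = 1/100 > 0` quantitatively.

* §8 `chargedEnergyGap_of_periodicPricing` — the PERIODIC FORM suffices: if every periodic `Q`
  pays `κ` per charged motif site (charge read in the infinite point set `Q.points`) above `e*`,
  then `NoBoundary (1/100) κ`, hence the crux (far periodisation `periodiseFar` with period
  `8D + 8`; `isChargeFree_toPoint_iff`, `motifCharged_periodiseFar`; no `BddBelow` needed).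
  The converse (crux ⇒ periodic form) IS proved in the companion modules `BlocksLocal` /
  `PeriodicFormConverse` (block trial states + deep block points keep their charge):
  **`chargedEnergyGap_iff_periodicPricing : ChargedEnergyGap ↔ ∃ κ > 0, PeriodicPricing (1/100) κ`**
  — the crux is EXACTLY "every periodic configuration of `ℝ³` pays `κ` per charged motif site
  above `e*`", a statement about periodic configurations only.

* §9 (cycle 3; Lean in parts VIII/IX, re-exported below) **ONE CONSTANT**:
  `chargedEnergyGap_iff_kappaMax_pos : ChargedEnergyGap ↔ 0 < kappaMax (1/100)`,
  `noBoundary_iff_le_kappaMax : NoBoundary η κ ↔ κ ≤ kappaMax η`, `gapWith_kappaMax : GapWith η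
  (kappaMax η) 0` (unconditional!), `kappaMax_le_ratio` (every charged configuration is a certified
  upper bound), `kappaMax_le_dimer`.  **PERIODIC SIDE** (what any proof must deliver, via part VII):
  `chargedFraction_le_of_periodicPricing` (`#charged motif/#motif ≤ (e(Q) − e*)/κ` for EVERY periodic
  `Q`), `forall_isChargeFree_of_periodicPricing` / `isChargeFree_of_isLeast` (a periodic LJ ground
  state — the `P` of `HasPeriodicGroundStateEnergy`, conjunct (i) of `Crystallization` — is
  charge-free AT EVERY POINT), `le_energyPerParticle_of_forall_charged` (every fully charged periodic
  configuration has `e(Q) ≥ e* + κ`: bcc, sc, A15, … AND hcp/fcc strained homogeneously past 1 %),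
  `tendsto_chargedFraction_of_chargedEnergyGap` (minimising sequences have charged fraction `→ 0`,
  the periodic twin of the target `ZeroChargeBulk`).  **KILL CRITERIA over periodic configurations
  only** (no finite-`N` bookkeeping): `not_chargedEnergyGap_of_charged_minimiser` (one periodic ground
  state with one charged point), `not_chargedEnergyGap_of_cheap_periodic_charge`,
  `not_chargedEnergyGap_of_forall_charged_near` (fully charged periodic `Q_n` with `e(Q_n) → e*`).
  **BLINDNESS**: `isChargeFree_barlowStacking` (every point of `barlowStacking a h s`, any Hägg `s`,
  `a > 0`, `h² = ⅔a²`, `0 ≤ η`, `1 + η < √2`), `motifCharged_idealBarlowQ_eq_zero`,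
  `periodicPricing_at_idealBarlowQ`, `motifCharged_hcp_fcc_eq_zero`, `exists_isChargeFree`: the
  pricing holds with zero charge at EVERY ideal close-packed periodic configuration, whatever the
  stacking word and the lattice constant — so the three kill criteria can fire only through
  NON-close-packed periodic configurations or close-packed ones distorted beyond the tolerance, and
  the crux carries no information on hcp-vs-fcc or on the density (charge form of the barrier
  `ShortRangeStackingBlindness`).

## Why it resists (read before trying to kill it)

By §3–§4 a kill is exactly: for every `κ > 0` ONE injective `y` with
`E_LJ(y) − N·e* < κ·#charged(1/100, y)` (`not_chargedEnergyGap_of_cheap_charge`), and such a `y`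
is a near-minimiser (`nearMinimiser_of_violation`).  Certifying it in Lean needs `e*` from BELOW
to precision `κ` per particle along an explicit family — a sharp lower bound on the periodic
Lennard-Jones minimum, which nobody has (tree floor: `E ≥ −(2³²/12)N`; Yuhjtman `−1.193N`;
`e* ≈ −0.7176`).  So no QUANTITATIVE variant (a specific `κ`, `C = 0`, another exponent `< 1`)
is Lean-refutable either; only junk-driven variants (§5, `¬0714`) and sign facts (§3) are.
In the language of §9: a kill is exactly `κ_max(1/100) = 0`, i.e. charged configurations whose
excess per charged site is arbitrarily small; every mechanism found has a floor (threshold law: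
the cheapest carrier is a bond pinched just past the tolerance, price `≈ 0.4·η²·(1 ∓ relaxation)`,
`≈ 3–4·10⁻⁵` at `η = 1/100`; cycle-3 kit job j010019 re-measures it with relaxation, random
few-atom patterns and the η-scaling), and `κ_max = 0` would need a NON-close-packed periodic
near-minimiser of `e_LJ` (§9 blindness: close-packed candidates carry no charge at all).
Physically (numerics below and g1's), every charge mechanism found costs `≥ 2·10⁻⁵` per charged
site: localised threshold distortions inside a Barlow crystal (one 0.85 % bond pinch charges
≈ 20 sites for `ΔE ≈ 7·10⁻⁴`), homogeneous threshold strains `≥ 1.5·10⁻⁴`, planar slips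
`≈ 10⁻⁴`, vacancies `0.12`, surfaces `0.17`, isolated atoms `0.72`, non-close-packed phases
`≥ 2·10⁻²` per site.  A zero-cost mechanism would need either a non-Barlow periodic minimiser of
`e_LJ` (none known; hcp wins all comparisons in print) or charge riding on a zero mode of the
optimal crystal (none: a charge needs a ≥ 1 % relative distortion inside some link, whose links
see ≤ 55 sites, at harmonic cost ≥ c·(0.005 a*)² per displaced atom).
-/

noncomputable section

namespace Summit.AtomisticToContinuum.Crystallization.Cruxes.ChargedEnergyGap.Disproof

open Literature.MathematicalPhysics.StatisticalMechanics
open Literature.Geometry.DiscreteGeometry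
open Summit.AtomisticToContinuum.Crystallization.Theses.PricedLinkCensus
open scoped BigOperators

/-! ## §0. The crux, parametrised -/

/-- Ambient space `ℝ³`. -/
abbrev E3 : Type := EuclideanSpace ℝ (Fin 3)

/-- `e* = ⨅_Q e_LJ(Q)`, the infimum of the Lennard-Jones energy per particle over periodic
configurations of `ℝ³` (a conditionally complete infimum: the junk value `0` if the range is not
bounded below — item 0714 `CrysPeriodicBddBelow`). -/
def eStar : ℝ := ⨅ Q : PeriodicConfiguration 3, Q.energyPerParticle lennardJones

/-- The number of charged (= not charge-free at tolerance `η`) sites of a finite configuration. -/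
def charged (η : ℝ) {N : ℕ} (y : Fin N → E3) : ℕ := Nat.card {i : Fin N // ¬ IsChargeFree η y i}

/-- The crux inequality with parameters: tolerance `η`, price `κ`, boundary allowance `C`. -/
def GapWith (η κ C : ℝ) : Prop :=
  ∀ (N : ℕ) (y : Fin N → E3), Function.Injective y →
    (N : ℝ) * eStar + κ * (charged η y : ℝ) - C * (N : ℝ) ^ (2 / 3 : ℝ) ≤
      interactionEnergy lennardJones y

/-- The same inequality WITHOUT boundary allowance (`C = 0`). -/
def NoBoundary (η κ : ℝ) : Prop :=
  ∀ (N : ℕ) (y : Fin N → E3), Function.Injective y →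
    (N : ℝ) * eStar + κ * (charged η y : ℝ) ≤ interactionEnergy lennardJones y

/-- The crux is `∃ κ > 0, ∃ C, GapWith (1/100) κ C`, by `Iff.rfl`. -/
theorem chargedEnergyGap_iff : ChargedEnergyGap ↔ ∃ κ C : ℝ, 0 < κ ∧ GapWith (1 / 100) κ C :=
  Iff.rfl

/-! ## §1. Small configurations: with at most twelve sites every site is charged -/

/-- A site whose index type has at most `12` elements is never charge-free: its neighbour set
misses the site itself, so it has at most `11` elements. -/
theorem not_isChargeFree_of_card_le {ι X : Type*} [PseudoMetricSpace X] [Finite ι]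
    (h : Nat.card ι ≤ 12) (η : ℝ) (y : ι → X) (i : ι) : ¬ IsChargeFree η y i := by
  intro hcf
  have hsub : (bondGraph η y).neighborSet i ⊆ {k | k ≠ i} := by
    intro k hk
    exact ((bondGraph η y).ne_of_adj hk).symm
  have hlt : ({k | k ≠ i} : Set ι).ncard < Nat.card ι := by
    have : ({k | k ≠ i} : Set ι) = {i}ᶜ := by ext k; simp
    rw [this, Set.ncard_compl, Set.ncard_singleton]
    have : 0 < Nat.card ι := Nat.card_pos_iff.2 ⟨⟨i⟩, inferInstance⟩
    omega
  have h12 := hcf.1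
  have := Set.ncard_le_ncard hsub (Set.toFinite _)
  omega

/-- Hence a configuration of `N ≤ 12` points has exactly `N` charged sites. -/
theorem charged_eq_of_le {η : ℝ} {N : ℕ} (hN : N ≤ 12) (y : Fin N → E3) : charged η y = N := by
  unfold charged
  have h : ∀ i : Fin N, ¬ IsChargeFree η y i := fun i =>
    not_isChargeFree_of_card_le (by simpa using hN) η y i
  rw [Nat.card_congr (Equiv.subtypeUnivEquiv h), Nat.card_eq_fintype_card, Fintype.card_fin]

/-- The empty configuration has no charged site. -/
theorem charged_zero {η : ℝ} (y : Fin 0 → E3) : charged η y = 0 := charged_eq_of_le (by norm_num) y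


/-! ## §2. Far translated copies: the boundary allowance `C·N^(2/3)` is not load-bearing -/

section Copies

variable {N : ℕ}

/-- The first coordinate unit vector `e₀`. -/
def e0 : E3 := EuclideanSpace.single 0 1

/-- `‖e₀‖ = 1`. -/
@[simp] theorem norm_e0 : ‖e0‖ = 1 := by
  simp [e0]

/-- A size parameter: `D(y) = Σᵢ ‖yᵢ‖`, so that `‖yᵢ‖ ≤ D` and all mutual distances are `≤ 2D`. -/
def Dsum (y : Fin N → E3) : ℝ := ∑ i, ‖y i‖

/-- `0 ≤ D(y)`. -/
theorem Dsum_nonneg (y : Fin N → E3) : 0 ≤ Dsum y :=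
  Finset.sum_nonneg fun _ _ => norm_nonneg _

/-- `‖yᵢ‖ ≤ D(y)`. -/
theorem norm_le_Dsum (y : Fin N → E3) (i : Fin N) : ‖y i‖ ≤ Dsum y :=
  Finset.single_le_sum (f := fun i => ‖y i‖) (fun _ _ => norm_nonneg _) (Finset.mem_univ i)

/-- All mutual distances are at most `2D(y)`. -/
theorem dist_le_two_Dsum (y : Fin N → E3) (i j : Fin N) : dist (y i) (y j) ≤ 2 * Dsum y := by
  rw [dist_eq_norm]
  linarith [norm_sub_le (y i) (y j), norm_le_Dsum y i, norm_le_Dsum y j]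

/-- Nearest-neighbour distances are at most `2D(y)` (when there is another site). -/
theorem nearestDist_le_two_Dsum (y : Fin N → E3) {i j : Fin N} (h : j ≠ i) :
    nearestDist y i ≤ 2 * Dsum y :=
  (nearestDist_le_dist y h).trans (dist_le_two_Dsum y i j)

/-- `M` translated copies of `y` at spacing `L` along `e₀`, indexed by `Fin M × Fin N`. -/
def copies (M : ℕ) (L : ℝ) (y : Fin N → E3) : Fin M × Fin N → E3 :=
  fun p => y p.2 + (((p.1 : ℕ) : ℝ) * L) • e0

/-- The same configuration re-indexed by `Fin (M * N)`. -/
def copiesFin (M : ℕ) (L : ℝ) (y : Fin N → E3) : Fin (M * N) → E3 :=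
  copies M L y ∘ finProdFinEquiv.symm

/-- Unfolding `copiesFin`. -/
theorem copiesFin_apply (M : ℕ) (L : ℝ) (y : Fin N → E3) (a : Fin (M * N)) :
    copiesFin M L y a = copies M L y (finProdFinEquiv.symm a) := rfl

/-- Distances inside one copy are those of `y`. -/
theorem dist_copies_same (M : ℕ) (L : ℝ) (y : Fin N → E3) (c : Fin M) (i j : Fin N) :
    dist (copies M L y (c, i)) (copies M L y (c, j)) = dist (y i) (y j) := by
  simp [copies, dist_add_right]

/-- Distances between different copies are at least `L − 2D` (for `L ≥ 0`). -/
theorem le_dist_copies_ne (M : ℕ) {L : ℝ} (hL : 0 ≤ L) (y : Fin N → E3) {p q : Fin M × Fin N}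
    (h : p.1 ≠ q.1) : L - 2 * Dsum y ≤ dist (copies M L y p) (copies M L y q) := by
  have hcc : (1 : ℝ) ≤ |((p.1 : ℕ) : ℝ) - ((q.1 : ℕ) : ℝ)| := by
    have : (p.1 : ℕ) ≠ (q.1 : ℕ) := fun h' => h (Fin.ext h')
    rcases lt_or_gt_of_ne this with hlt | hlt
    · have : ((p.1 : ℕ) : ℝ) + 1 ≤ ((q.1 : ℕ) : ℝ) := by exact_mod_cast hlt
      rw [abs_of_neg (by linarith)]
      linarith
    · have : ((q.1 : ℕ) : ℝ) + 1 ≤ ((p.1 : ℕ) : ℝ) := by exact_mod_cast hlt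
      rw [abs_of_pos (by linarith)]
      linarith
  have hv : ‖((((p.1 : ℕ) : ℝ) * L) • e0 - (((q.1 : ℕ) : ℝ) * L) • e0 : E3)‖ =
      |((p.1 : ℕ) : ℝ) - ((q.1 : ℕ) : ℝ)| * L := by
    rw [← sub_smul, norm_smul, norm_e0, mul_one, ← sub_mul, Real.norm_eq_abs, abs_mul,
      abs_of_nonneg hL]
  have hL' : L ≤ |((p.1 : ℕ) : ℝ) - ((q.1 : ℕ) : ℝ)| * L := by nlinarith
  have key : ‖((((p.1 : ℕ) : ℝ) * L) • e0 - (((q.1 : ℕ) : ℝ) * L) • e0 : E3)‖ - ‖y q.2 - y p.2‖ ≤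
      dist (copies M L y p) (copies M L y q) := by
    rw [dist_eq_norm]
    have e : copies M L y p - copies M L y q =
        ((((p.1 : ℕ) : ℝ) * L) • e0 - (((q.1 : ℕ) : ℝ) * L) • e0) - (y q.2 - y p.2) := by
      simp only [copies]; abel
    rw [e]
    exact norm_sub_norm_le _ _
  have hd : ‖y q.2 - y p.2‖ ≤ 2 * Dsum y := by
    rw [← dist_eq_norm]; exact dist_le_two_Dsum y q.2 p.2
  linarith

/-- The copies of an injective configuration form an injective configuration (`L > 2D`). -/
theorem copies_injective (M : ℕ) {L : ℝ} {y : Fin N → E3} (hL : 2 * Dsum y < L)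
    (hy : Function.Injective y) : Function.Injective (copies M L y) := by
  intro p q hpq
  by_cases h : p.1 = q.1
  · have h2 : y p.2 = y q.2 := by
      have := congrArg (fun v => v - (((p.1 : ℕ) : ℝ) * L) • e0) hpq
      simpa [copies, h] using this
    exact Prod.ext h (hy h2)
  · have hL0 : 0 ≤ L := by linarith [Dsum_nonneg y]
    have := le_dist_copies_ne M hL0 y h
    rw [hpq, dist_self] at this
    linarith

/-- `copiesFin` of an injective configuration is injective (`L > 2D`). -/
theorem copiesFin_injective (M : ℕ) {L : ℝ} {y : Fin N → E3} (hL : 2 * Dsum y < L)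
    (hy : Function.Injective y) : Function.Injective (copiesFin M L y) :=
  (copies_injective M hL hy).comp finProdFinEquiv.symm.injective

/-- **Energy of far copies.** If the copies are at mutual distances `≥ 1` (i.e. `L − 2D ≥ 1`),
where `V_LJ ≤ 0`, the energy of `M` copies is at most `M` times the energy of `y`. -/
theorem interactionEnergy_copiesFin_le (M : ℕ) {L : ℝ} (y : Fin N → E3)
    (hL : 1 ≤ L - 2 * Dsum y) :
    interactionEnergy lennardJones (copiesFin M L y) ≤
      (M : ℝ) * interactionEnergy lennardJones y := by
  have hL0 : 0 ≤ L := by linarith [Dsum_nonneg y]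
  have h2 := two_mul_interactionEnergy_eq_sum_sum lennardJones lennardJones_zero (copiesFin M L y)
  have h2y := two_mul_interactionEnergy_eq_sum_sum lennardJones lennardJones_zero y
  -- re-index the double sum by `Fin M × Fin N`
  have hre : ∑ a, ∑ b, lennardJones (dist (copiesFin M L y a) (copiesFin M L y b)) =
      ∑ p : Fin M × Fin N, ∑ q : Fin M × Fin N,
        lennardJones (dist (copies M L y p) (copies M L y q)) := by
    simp only [copiesFin_apply]
    exact (finProdFinEquiv.symm.sum_comp (fun p => ∑ b : Fin (M * N),
      lennardJones (dist (copies M L y p) (copies M L y (finProdFinEquiv.symm b))))).trans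
      (Finset.sum_congr rfl fun p _ => finProdFinEquiv.symm.sum_comp
        (fun q => lennardJones (dist (copies M L y p) (copies M L y q))))
  -- bound each row: the own copy gives the `y`-row, the other copies contribute `≤ 0`
  have hrow : ∀ (c : Fin M) (i : Fin N),
      ∑ q : Fin M × Fin N, lennardJones (dist (copies M L y (c, i)) (copies M L y q)) ≤
        ∑ j, lennardJones (dist (y i) (y j)) := by
    intro c i
    rw [Fintype.sum_prod_type, ← Finset.add_sum_erase _ _ (Finset.mem_univ c)]
    have hown : ∑ j : Fin N, lennardJones (dist (copies M L y (c, i)) (copies M L y (c, j))) =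
        ∑ j, lennardJones (dist (y i) (y j)) := by
      simp only [dist_copies_same]
    have hrest : ∑ c' ∈ Finset.univ.erase c, ∑ j : Fin N,
        lennardJones (dist (copies M L y (c, i)) (copies M L y (c', j))) ≤ 0 := by
      refine Finset.sum_nonpos fun c' hc' => Finset.sum_nonpos fun j _ => ?_
      have hne : ((c, i) : Fin M × Fin N).1 ≠ ((c', j) : Fin M × Fin N).1 :=
        fun h => (Finset.ne_of_mem_erase hc') h.symm
      exact lennardJones_nonpos (hL.trans (le_dist_copies_ne M hL0 y hne))
    linarith
  have hsum : ∑ p : Fin M × Fin N, ∑ q : Fin M × Fin N,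
        lennardJones (dist (copies M L y p) (copies M L y q)) ≤
      (M : ℝ) * ∑ i, ∑ j, lennardJones (dist (y i) (y j)) := by
    rw [Fintype.sum_prod_type]
    calc ∑ c : Fin M, ∑ i : Fin N, ∑ q : Fin M × Fin N,
          lennardJones (dist (copies M L y (c, i)) (copies M L y q))
        ≤ ∑ _c : Fin M, ∑ i : Fin N, ∑ j, lennardJones (dist (y i) (y j)) :=
          Finset.sum_le_sum fun c _ => Finset.sum_le_sum fun i _ => hrow c i
      _ = (M : ℝ) * ∑ i, ∑ j, lennardJones (dist (y i) (y j)) := by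
          rw [Finset.sum_const, Finset.card_univ, Fintype.card_fin, nsmul_eq_mul]
  have hfin : 2 * interactionEnergy lennardJones (copiesFin M L y) ≤
      (M : ℝ) * (2 * interactionEnergy lennardJones y) := by
    rw [h2, h2y, hre]; exact hsum
  linarith

/-- A convenient spacing: `L(y) = 8·D(y) + 8`. Then `L − 2D = 6D + 8` exceeds `1`, `2D` and
`2·(2D)` (twice the largest possible nearest-neighbour distance). -/
def spacing (y : Fin N → E3) : ℝ := 8 * Dsum y + 8

/-- `0 ≤ L(y)`. -/
theorem spacing_nonneg (y : Fin N → E3) : 0 ≤ spacing y := by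
  unfold spacing; linarith [Dsum_nonneg y]

/-- `1 ≤ L(y) − 2D(y)`. -/
theorem one_le_spacing_sub (y : Fin N → E3) : 1 ≤ spacing y - 2 * Dsum y := by
  unfold spacing; linarith [Dsum_nonneg y]

/-- `2D(y) < L(y)`. -/
theorem two_Dsum_lt_spacing (y : Fin N → E3) : 2 * Dsum y < spacing y := by
  unfold spacing; linarith [Dsum_nonneg y]

/-- Cross-copy distances at the spacing `L(y)`: at least `6D + 8`. -/
theorem le_dist_copies_ne_spacing (M : ℕ) (y : Fin N → E3) {p q : Fin M × Fin N}
    (h : p.1 ≠ q.1) : 6 * Dsum y + 8 ≤ dist (copies M (spacing y) y p) (copies M (spacing y) y q) := by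
  have h' : spacing y - 2 * Dsum y = 6 * Dsum y + 8 := by unfold spacing; ring
  rw [← h']
  exact le_dist_copies_ne M (spacing_nonneg y) y h

/-- **Nearest-neighbour distances are unchanged in the copies** (for `N ≥ 2`, i.e. when site `i`
has another site `j ≠ i`). -/
theorem nearestDist_copies (M : ℕ) (y : Fin N → E3) (c : Fin M) {i : Fin N} (hi : ∃ j, j ≠ i) :
    nearestDist (copies M (spacing y) y) (c, i) = nearestDist y i := by
  obtain ⟨j₀, hj₀, hnn⟩ := exists_nearestDist_eq_dist y hi
  apply le_antisymm
  · have hne : ((c, j₀) : Fin M × Fin N) ≠ (c, i) := fun h => hj₀ (Prod.ext_iff.1 h).2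
    calc nearestDist (copies M (spacing y) y) (c, i)
        ≤ dist (copies M (spacing y) y (c, i)) (copies M (spacing y) y (c, j₀)) :=
          nearestDist_le_dist _ hne
      _ = nearestDist y i := by rw [dist_copies_same, hnn]
  · refine le_nearestDist ⟨(c, j₀), fun h => hj₀ (Prod.ext_iff.1 h).2⟩ fun q hq => ?_
    by_cases hc : q.1 = c
    · have hq2 : q.2 ≠ i := fun h => hq (Prod.ext hc h)
      obtain ⟨c', j⟩ := q
      simp only at hc
      subst hc
      rw [dist_copies_same]
      exact nearestDist_le_dist y hq2
    · have hne : ((c, i) : Fin M × Fin N).1 ≠ q.1 := fun h => hc h.symm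
      calc nearestDist y i ≤ 2 * Dsum y := nearestDist_le_two_Dsum y hj₀
        _ ≤ 6 * Dsum y + 8 := by linarith [Dsum_nonneg y]
        _ ≤ _ := le_dist_copies_ne_spacing M y hne

/-- **The bond graph of the copies is the disjoint union of the bond graphs** (tolerance
`0 ≤ η ≤ 1`, `N ≥ 2`): two sites are bonded iff they lie in the same copy and are bonded in `y`. -/
theorem bondGraph_copies_adj (M : ℕ) {η : ℝ} (hη1 : η ≤ 1) (y : Fin N → E3)
    (hN : ∀ i : Fin N, ∃ j, j ≠ i) (p q : Fin M × Fin N) :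
    (bondGraph η (copies M (spacing y) y)).Adj p q ↔ p.1 = q.1 ∧ (bondGraph η y).Adj p.2 q.2 := by
  rw [bondGraph_adj, bondGraph_adj]
  obtain ⟨c, i⟩ := p
  obtain ⟨c', j⟩ := q
  simp only [nearestDist_copies M y _ (hN _)]
  constructor
  · rintro ⟨hne, hle⟩
    by_cases hc : c = c'
    · subst hc
      refine ⟨rfl, fun h => hne (by rw [h]), ?_⟩
      rwa [dist_copies_same] at hle
    · exfalso
      have hfar := le_dist_copies_ne_spacing M y (p := (c, i)) (q := (c', j)) hc
      obtain ⟨j₀, hj₀⟩ := hN i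
      have hnn : nearestDist y i ≤ 2 * Dsum y := nearestDist_le_two_Dsum y hj₀
      have hmin : min (nearestDist y i) (nearestDist y j) ≤ 2 * Dsum y :=
        (min_le_left _ _).trans hnn
      have h1 : (1 + η) * min (nearestDist y i) (nearestDist y j) ≤ 2 * (2 * Dsum y) :=
        mul_le_mul (by linarith) hmin (le_min (nearestDist_nonneg _ _) (nearestDist_nonneg _ _))
          (by norm_num)
      linarith [Dsum_nonneg y]
  · rintro ⟨hc, hne, hle⟩
    subst hc
    refine ⟨fun h => hne (Prod.ext_iff.1 h).2, ?_⟩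
    rwa [dist_copies_same]

/-- Neighbour sets in the copies are the images of the neighbour sets of `y`. -/
theorem neighborSet_copies (M : ℕ) {η : ℝ} (hη1 : η ≤ 1) (y : Fin N → E3)
    (hN : ∀ i : Fin N, ∃ j, j ≠ i) (c : Fin M) (i : Fin N) :
    (bondGraph η (copies M (spacing y) y)).neighborSet (c, i) =
      Prod.mk c '' (bondGraph η y).neighborSet i := by
  ext ⟨c', j⟩
  rw [SimpleGraph.mem_neighborSet, bondGraph_copies_adj M hη1 y hN, Set.mem_image]
  constructor
  · rintro ⟨hc, hadj⟩
    simp only at hc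
    exact ⟨j, hadj, by rw [hc]⟩
  · rintro ⟨j', hj', h⟩
    obtain ⟨rfl, rfl⟩ := Prod.ext_iff.1 h
    exact ⟨rfl, hj'⟩

/-- `Prod.mk c` is injective. -/
theorem prodMk_injective' {α β : Type*} (c : α) : Function.Injective (Prod.mk c : β → α × β) :=
  fun _ _ h => (Prod.ext_iff.1 h).2

/-- Ring numbers along bonds are unchanged in the copies. -/
theorem ringNumber_copies (M : ℕ) {η : ℝ} (hη1 : η ≤ 1) (y : Fin N → E3)
    (hN : ∀ i : Fin N, ∃ j, j ≠ i) (c : Fin M) (i j : Fin N) :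
    ringNumber η (copies M (spacing y) y) (c, i) (c, j) = ringNumber η y i j := by
  rw [ringNumber_def, ringNumber_def, neighborSet_copies M hη1 y hN,
    neighborSet_copies M hη1 y hN, ← Set.image_inter (prodMk_injective' c),
    Set.ncard_image_of_injective _ (prodMk_injective' c)]

/-- **Charge-freeness is unchanged in the copies.** -/
theorem isChargeFree_copies_iff (M : ℕ) {η : ℝ} (hη1 : η ≤ 1) (y : Fin N → E3)
    (hN : ∀ i : Fin N, ∃ j, j ≠ i) (c : Fin M) (i : Fin N) :
    IsChargeFree η (copies M (spacing y) y) (c, i) ↔ IsChargeFree η y i := by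
  rw [isChargeFree_iff, isChargeFree_iff, neighborSet_copies M hη1 y hN,
    Set.ncard_image_of_injective _ (prodMk_injective' c), Set.forall_mem_image]
  refine and_congr_right fun _ => forall₂_congr fun j _ => ?_
  rw [ringNumber_copies M hη1 y hN]

/-- **The copies carry `M` times as many charged sites.** -/
theorem charged_copiesFin (M : ℕ) {η : ℝ} (hη1 : η ≤ 1) (y : Fin N → E3)
    (hN : ∀ i : Fin N, ∃ j, j ≠ i) :
    charged η (copiesFin M (spacing y) y) = M * charged η y := by
  unfold charged
  have e1 : {a : Fin (M * N) // ¬ IsChargeFree η (copiesFin M (spacing y) y) a} ≃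
      {p : Fin M × Fin N // ¬ IsChargeFree η y p.2} := by
    refine (finProdFinEquiv.symm.subtypeEquiv fun a => ?_)
    rw [copiesFin, isChargeFree_comp_equiv_iff, isChargeFree_copies_iff M hη1 y hN]
  have e2 : {p : Fin M × Fin N // ¬ IsChargeFree η y p.2} ≃
      Fin M × {i : Fin N // ¬ IsChargeFree η y i} :=
    { toFun := fun p => (p.1.1, ⟨p.1.2, p.2⟩)
      invFun := fun q => ⟨(q.1, q.2.1), q.2.2⟩
      left_inv := fun p => rfl
      right_inv := fun q => rfl }
  rw [Nat.card_congr (e1.trans e2), Nat.card_prod, Nat.card_eq_fintype_card, Fintype.card_fin]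

end Copies


/-! ## §3. The no-boundary reduction and its corollaries -/

section NoBoundaryReduction

/-- `((m³)·x)^(2/3) = m²·x^(2/3)` for `m, x ≥ 0`. -/
theorem cube_mul_rpow {m x : ℝ} (hm : 0 ≤ m) (hx : 0 ≤ x) :
    ((m ^ 3) * x) ^ (2 / 3 : ℝ) = m ^ 2 * x ^ (2 / 3 : ℝ) := by
  rw [Real.mul_rpow (pow_nonneg hm 3) hx]
  congr 1
  rw [show (m ^ 3) = m ^ (3 : ℝ) by norm_cast, ← Real.rpow_mul hm,
    show (3 : ℝ) * (2 / 3) = 2 by norm_num, Real.rpow_two]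

/-- In `Fin N` with `N ≥ 2` every index has another one. -/
theorem exists_ne_of_two_le {N : ℕ} (hN : 2 ≤ N) (i : Fin N) : ∃ j : Fin N, j ≠ i := by
  by_cases hi : (i : ℕ) = 0
  · exact ⟨⟨1, by omega⟩, fun h => by rw [Fin.ext_iff] at h; simp at h; omega⟩
  · exact ⟨⟨0, by omega⟩, fun h => hi (by rw [← h])⟩

/-- **Amplification by far copies** (`N ≥ 2`): a priced gap with ANY boundary allowance `C`
forces the allowance-free inequality `N·e* + κ·#charged(y) ≤ E(y)` for every injective `y`.
Proof: apply the gap to `M = m³` far translated copies of `y` (charged count `× M`, energy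
`≤ M·E(y)`, `C·(MN)^(2/3)/M → 0`). -/
theorem noBoundaryAt_of_gapWith {η κ C : ℝ} (hη1 : η ≤ 1) (h : GapWith η κ C) {N : ℕ}
    (hN : 2 ≤ N) (y : Fin N → E3) (hy : Function.Injective y) :
    (N : ℝ) * eStar + κ * (charged η y : ℝ) ≤ interactionEnergy lennardJones y := by
  have hN' : ∀ i : Fin N, ∃ j, j ≠ i := exists_ne_of_two_le hN
  have key : ∀ M : ℕ, ((M : ℝ) * N) * eStar + κ * ((M : ℝ) * charged η y) -
      C * ((M : ℝ) * N) ^ (2 / 3 : ℝ) ≤ (M : ℝ) * interactionEnergy lennardJones y := by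
    intro M
    have hg := h (M * N) (copiesFin M (spacing y) y)
      (copiesFin_injective M (two_Dsum_lt_spacing y) hy)
    rw [charged_copiesFin M hη1 y hN'] at hg
    push_cast at hg
    exact hg.trans (interactionEnergy_copiesFin_le M y (one_le_spacing_sub y))
  refine le_of_not_gt fun hlt => ?_
  have hε0 : 0 < (N : ℝ) * eStar + κ * (charged η y : ℝ) - interactionEnergy lennardJones y := by
    linarith
  obtain ⟨m₀, hm₀⟩ := exists_nat_gt (C * (N : ℝ) ^ (2 / 3 : ℝ) /
    ((N : ℝ) * eStar + κ * (charged η y : ℝ) - interactionEnergy lennardJones y))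
  have hm1 : C * (N : ℝ) ^ (2 / 3 : ℝ) < ((m₀ + 1 : ℕ) : ℝ) *
      ((N : ℝ) * eStar + κ * (charged η y : ℝ) - interactionEnergy lennardJones y) := by
    rw [div_lt_iff₀ hε0] at hm₀
    push_cast
    nlinarith
  have hm2 : (0 : ℝ) < (((m₀ + 1 : ℕ) : ℝ)) ^ 2 := by positivity
  have hkey := key ((m₀ + 1) ^ 3)
  push_cast [Nat.cast_pow] at hkey
  push_cast at hm1 hm2
  rw [cube_mul_rpow (by positivity) (Nat.cast_nonneg N)] at hkey
  nlinarith [mul_lt_mul_of_pos_right hm1 hm2, hkey]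

/-- The unit dimer `{0, e₀}`. -/
def dimer : Fin 2 → E3 := ![0, e0]

/-- `e₀ ≠ 0`. -/
theorem e0_ne_zero : e0 ≠ 0 := by
  intro h
  have := norm_e0
  rw [h, norm_zero] at this
  norm_num at this

/-- The dimer consists of two distinct points. -/
theorem dimer_injective : Function.Injective dimer := by
  intro i j h
  fin_cases i <;> fin_cases j <;> simp_all [dimer, e0_ne_zero, e0_ne_zero.symm]

/-- First point of the dimer. -/
@[simp] theorem dimer_zero : dimer 0 = 0 := rfl

/-- Second point of the dimer. -/
@[simp] theorem dimer_one : dimer 1 = e0 := rfl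

/-- `E(dimer) = V_LJ(1) = −1/12`. -/
theorem interactionEnergy_dimer : interactionEnergy lennardJones dimer = -1 / 12 := by
  have h2 := two_mul_interactionEnergy_eq_sum_sum lennardJones lennardJones_zero dimer
  simp only [Fin.sum_univ_two, dimer_zero, dimer_one,
    dist_self, lennardJones_zero, dist_zero_left, dist_zero_right, norm_e0, norm_zero,
    lennardJones_one] at h2
  linarith

/-- **The dimer bound**: a priced gap at tolerance `η ≤ 1` forces `e* + κ ≤ −1/24`
(`N·e* + κ·#charged ≤ E` at the dimer: both sites charged, `E = −1/12`). In particular every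
admissible price satisfies `κ ≤ −1/24 − e*` (≈ 0.676 numerically) and `e* < −1/24`. -/
theorem eStar_add_le_of_gapWith {η κ C : ℝ} (hη1 : η ≤ 1) (h : GapWith η κ C) :
    eStar + κ ≤ -1 / 24 := by
  have := noBoundaryAt_of_gapWith hη1 h le_rfl dimer dimer_injective
  rw [charged_eq_of_le (by norm_num) dimer, interactionEnergy_dimer] at this
  push_cast at this
  linarith

/-- **No-boundary reduction**: `GapWith η κ C → NoBoundary η κ` (`η ≤ 1`; all `N`, the cases
`N = 0, 1` directly). -/
theorem noBoundary_of_gapWith {η κ C : ℝ} (hη1 : η ≤ 1) (h : GapWith η κ C) :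
    NoBoundary η κ := by
  intro N y hy
  rcases Nat.lt_or_ge N 2 with hN | hN
  · interval_cases N
    · rw [charged_zero, interactionEnergy_of_subsingleton]
      simp
    · rw [charged_eq_of_le (by norm_num) y, interactionEnergy_of_subsingleton]
      push_cast
      linarith [eStar_add_le_of_gapWith hη1 h]
  · exact noBoundaryAt_of_gapWith hη1 h hN y hy

/-- Conversely the allowance-free inequality is the gap with `C = 0`. -/
theorem gapWith_of_noBoundary {η κ : ℝ} (h : NoBoundary η κ) : GapWith η κ 0 := by
  intro N y hy
  have := h N y hy
  simpa using this

/-- **`ChargedEnergyGap ↔ ∃ κ > 0, NoBoundary (1/100) κ`**: the boundary allowance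
`−C·N^(2/3)` carries no content. -/
theorem chargedEnergyGap_iff_noBoundary :
    ChargedEnergyGap ↔ ∃ κ : ℝ, 0 < κ ∧ NoBoundary (1 / 100) κ := by
  rw [chargedEnergyGap_iff]
  constructor
  · rintro ⟨κ, C, hκ, h⟩
    exact ⟨κ, hκ, noBoundary_of_gapWith (by norm_num) h⟩
  · rintro ⟨κ, hκ, h⟩
    exact ⟨κ, 0, hκ, gapWith_of_noBoundary h⟩

/-- **Hidden dependence on item 0714 (`CrysPeriodicBddBelow`)**: the crux forces `e* < −1/24`,
hence the periodic energies per particle ARE bounded below (otherwise `⨅ = 0` is Lean's junk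
value); any proof of the crux proves item 0714 on the way. -/
theorem eStar_lt_of_chargedEnergyGap (h : ChargedEnergyGap) : eStar < -1 / 24 := by
  obtain ⟨κ, C, hκ, hg⟩ := chargedEnergyGap_iff.1 h
  linarith [eStar_add_le_of_gapWith (by norm_num : (1 / 100 : ℝ) ≤ 1) hg]

/-- **The crux implies item 0714**: the Lennard-Jones energies per particle of periodic configurations are bounded below (else `e* = 0` is junk and the dimer bound fails). -/
theorem bddBelow_of_chargedEnergyGap (h : ChargedEnergyGap) :
    BddBelow (Set.range fun Q : PeriodicConfiguration 3 => Q.energyPerParticle lennardJones) := by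
  by_contra hb
  have h0 : eStar = 0 := Real.iInf_of_not_bddBelow hb
  linarith [eStar_lt_of_chargedEnergyGap h]

/-- **Certified ceiling on the price**: every admissible `κ` satisfies `κ ≤ −1/24 − e*`. -/
theorem kappa_le_of_gapWith {η κ C : ℝ} (hη1 : η ≤ 1) (h : GapWith η κ C) : κ ≤ -1 / 24 - eStar := by
  linarith [eStar_add_le_of_gapWith hη1 h]

/-- **Kill criterion (per price).** ONE injective configuration undercutting
`N·e* + κ·#charged` refutes the gap at price `κ` for EVERY boundary allowance `C`. -/
theorem not_gapWith_of_witness {η κ : ℝ} (hη1 : η ≤ 1) {N : ℕ} {y : Fin N → E3}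
    (hy : Function.Injective y)
    (hlt : interactionEnergy lennardJones y < (N : ℝ) * eStar + κ * (charged η y : ℝ)) (C : ℝ) :
    ¬ GapWith η κ C := fun h =>
  absurd (noBoundary_of_gapWith hη1 h N y hy) (not_le.2 hlt)

/-- **Kill criterion (crux).** A family of injective configurations `y_κ` with
`E(y_κ) < N·e* + κ·#charged(y_κ)` for every `κ > 0` refutes `ChargedEnergyGap`. -/
theorem not_chargedEnergyGap_of_cheap_charge
    (h : ∀ κ : ℝ, 0 < κ → ∃ (N : ℕ) (y : Fin N → E3), Function.Injective y ∧
      interactionEnergy lennardJones y < (N : ℝ) * eStar + κ * (charged (1 / 100) y : ℝ)) :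
    ¬ ChargedEnergyGap := by
  rw [chargedEnergyGap_iff_noBoundary]
  rintro ⟨κ, hκ, hnb⟩
  obtain ⟨N, y, hy, hlt⟩ := h κ hκ
  exact absurd (hnb N y hy) (not_le.2 hlt)

/-- Prices are monotone: a gap at price `κ` gives the gap at every smaller price `κ' ≤ κ`
(with the same allowance), since `#charged ≥ 0`. -/
theorem gapWith_mono {η κ κ' C C' : ℝ} (hκ : κ' ≤ κ) (hC : C ≤ C') (h : GapWith η κ C) :
    GapWith η κ' C' := by
  intro N y hy
  have := h N y hy
  have h1 : κ' * (charged η y : ℝ) ≤ κ * (charged η y : ℝ) :=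
    mul_le_mul_of_nonneg_right hκ (Nat.cast_nonneg _)
  have h2 : C * (N : ℝ) ^ (2 / 3 : ℝ) ≤ C' * (N : ℝ) ^ (2 / 3 : ℝ) :=
    mul_le_mul_of_nonneg_right hC (Real.rpow_nonneg (Nat.cast_nonneg _) _)
  linarith

end NoBoundaryReduction

/-! ### §3b. Any sublinear power allowance `C·N^α`, `α < 1`, gives the same statement -/

section Exponent

/-- The crux inequality with a general power allowance `C·N^α`. -/
def GapWithExp (α η κ C : ℝ) : Prop :=
  ∀ (N : ℕ) (y : Fin N → E3), Function.Injective y →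
    (N : ℝ) * eStar + κ * (charged η y : ℝ) - C * (N : ℝ) ^ α ≤ interactionEnergy lennardJones y

/-- `GapWith` is the case `α = 2/3` (by `Iff.rfl`). -/
theorem gapWith_iff_gapWithExp (η κ C : ℝ) : GapWith η κ C ↔ GapWithExp (2 / 3) η κ C := Iff.rfl

/-- **Amplification for a general exponent `α < 1`** (`N ≥ 2`): `C·(MN)^α / M → 0`. -/
theorem noBoundaryAt_of_gapWithExp {α η κ C : ℝ} (hα : α < 1) (hη1 : η ≤ 1)
    (h : GapWithExp α η κ C) {N : ℕ} (hN : 2 ≤ N) (y : Fin N → E3) (hy : Function.Injective y) :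
    (N : ℝ) * eStar + κ * (charged η y : ℝ) ≤ interactionEnergy lennardJones y := by
  have hN' : ∀ i : Fin N, ∃ j, j ≠ i := exists_ne_of_two_le hN
  have key : ∀ M : ℕ, ((M : ℝ) * N) * eStar + κ * ((M : ℝ) * charged η y) -
      C * ((M : ℝ) ^ α * (N : ℝ) ^ α) ≤ (M : ℝ) * interactionEnergy lennardJones y := by
    intro M
    have hg := h (M * N) (copiesFin M (spacing y) y)
      (copiesFin_injective M (two_Dsum_lt_spacing y) hy)
    rw [charged_copiesFin M hη1 y hN'] at hg
    push_cast at hg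
    rw [Real.mul_rpow (Nat.cast_nonneg M) (Nat.cast_nonneg N)] at hg
    exact hg.trans (interactionEnergy_copiesFin_le M y (one_le_spacing_sub y))
  refine le_of_not_gt fun hlt => ?_
  set ε := (N : ℝ) * eStar + κ * (charged η y : ℝ) - interactionEnergy lennardJones y with hε
  have hε0 : 0 < ε := by rw [hε]; linarith
  -- from `key`: `M·ε ≤ C·M^α·N^α` for every `M`
  have key' : ∀ M : ℕ, (M : ℝ) * ε ≤ C * ((M : ℝ) ^ α * (N : ℝ) ^ α) := fun M => by
    have := key M; rw [hε]; linarith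
  have hNα : (0 : ℝ) < (N : ℝ) ^ α := Real.rpow_pos_of_pos (by exact_mod_cast (by omega : 0 < N)) α
  -- `M = 1`: so `C·N^α ≥ ε > 0`, in particular `C > 0`
  have h1 := key' 1
  simp only [Nat.cast_one, one_mul, Real.one_rpow] at h1
  have hC : 0 < C := by
    by_contra hC; push Not at hC
    have : C * (N : ℝ) ^ α ≤ 0 := mul_nonpos_of_nonpos_of_nonneg hC hNα.le
    linarith
  -- large `M`: `M^(α-1) → 0`
  have ht : Filter.Tendsto (fun x : ℝ => x ^ (-(1 - α))) Filter.atTop (nhds 0) :=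
    tendsto_rpow_neg_atTop (by linarith)
  have hev : ∀ᶠ x : ℝ in Filter.atTop, x ^ (-(1 - α)) < ε / (C * (N : ℝ) ^ α) :=
    ht.eventually (gt_mem_nhds (by positivity))
  obtain ⟨x₀, hx₀⟩ := Filter.eventually_atTop.1 hev
  obtain ⟨M, hM⟩ := exists_nat_gt (max x₀ 1)
  have hM1 : (1 : ℝ) < M := lt_of_le_of_lt (le_max_right _ _) hM
  have hMx : x₀ ≤ (M : ℝ) := (le_max_left _ _).trans hM.le
  have hMpos : (0 : ℝ) < M := by linarith
  have hsmall := hx₀ M hMx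
  -- `M^α = M · M^(α-1)`
  have hsplit : (M : ℝ) ^ α = (M : ℝ) * (M : ℝ) ^ (-(1 - α)) := by
    rw [show -(1 - α) = α - 1 by ring, Real.rpow_sub_one hMpos.ne', mul_div_cancel₀ _ hMpos.ne']
  have h2 := key' M
  rw [hsplit] at h2
  -- `M ε ≤ C · M · M^(α-1) · N^α < M · ε`
  have h3 : C * ((M : ℝ) * (M : ℝ) ^ (-(1 - α)) * (N : ℝ) ^ α) < (M : ℝ) * ε := by
    have := mul_lt_mul_of_pos_left hsmall (mul_pos hMpos (mul_pos hC hNα))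
    have hsimp : (M : ℝ) * (C * (N : ℝ) ^ α) * (ε / (C * (N : ℝ) ^ α)) = (M : ℝ) * ε := by
      field_simp
    rw [hsimp] at this
    nlinarith
  linarith

/-- Hence the general-exponent gap also forces the dimer bound and the allowance-free form. -/
theorem noBoundary_of_gapWithExp {α η κ C : ℝ} (hα : α < 1) (hη1 : η ≤ 1)
    (h : GapWithExp α η κ C) : NoBoundary η κ := by
  have hdimer : eStar + κ ≤ -1 / 24 := by
    have := noBoundaryAt_of_gapWithExp hα hη1 h le_rfl dimer dimer_injective
    rw [charged_eq_of_le (by norm_num) dimer, interactionEnergy_dimer] at this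
    push_cast at this
    linarith
  intro N y hy
  rcases Nat.lt_or_ge N 2 with hN | hN
  · interval_cases N
    · rw [charged_zero, interactionEnergy_of_subsingleton]
      simp
    · rw [charged_eq_of_le (by norm_num) y, interactionEnergy_of_subsingleton]
      push_cast
      linarith
  · exact noBoundaryAt_of_gapWithExp hα hη1 h hN y hy

/-- **The exponent `2/3` is immaterial**: for every `α < 1`,
`(∃ κ > 0, ∃ C, GapWithExp α (1/100) κ C) ↔ ChargedEnergyGap`. -/
theorem chargedEnergyGap_iff_exp {α : ℝ} (hα : α < 1) :
    (∃ κ C : ℝ, 0 < κ ∧ GapWithExp α (1 / 100) κ C) ↔ ChargedEnergyGap := by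
  rw [chargedEnergyGap_iff_noBoundary]
  constructor
  · rintro ⟨κ, C, hκ, h⟩
    exact ⟨κ, hκ, noBoundary_of_gapWithExp hα (by norm_num) h⟩
  · rintro ⟨κ, hκ, h⟩
    refine ⟨κ, 0, hκ, fun N y hy => ?_⟩
    have := h N y hy
    simpa using this

end Exponent


/-! ## §4. The `κ = 0` half holds with `C = 0`: `N·e* ≤ E_LJ(y)` by periodisation

Periodise an injective `y` with the cubic lattice `Lℤ³`, `L = 2Σᵢ‖yᵢ‖ + 2`: the periodic images
are at mutual distances `≥ 2`, where `V_LJ ≤ 0`, so `e(periodisation) ≤ E_LJ(y)/N`, whence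
`e* ≤ E_LJ(y)/N` as soon as `e*` is the genuine infimum (`BddBelow`, item 0714).  Consequently
the ENERGETIC half of the crux ("contains `liminf E(N)/N ≥ e*`", labelled open in the item's
informal text) is elementary in this formulation: the periodic infimum is an infimum over ALL
periodic configurations, dilute periodic arrays of clusters included.  The whole content of the
crux is carried by `0 < κ`.  (Construction ported from the sibling work file
`Cruxes/StarCoercivity/Disproof.lean` §5, generation 2, with the tree's `cubicLattice`.) -/

section Periodise

open Literature.Barriers.AtomisticToContinuum (cubicLattice cubicBasis cubicBasis_apply)

variable {N : ℕ} (x : Fin N → E3)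

/-- The period `L = 2·Σ‖x i‖ + 2`. -/
def period : ℝ := 2 * Dsum x + 2

/-- `0 < L`. -/
theorem period_pos : 0 < period x := by unfold period; linarith [Dsum_nonneg x]

/-- The period as a unit of `ℝ`. -/
def periodUnit : ℝˣ := Units.mk0 (period x) (period_pos x).ne'

/-- The unit's value is the period. -/
@[simp] theorem val_periodUnit : (periodUnit x : ℝ) = period x := rfl

/-- Coordinates of vectors of the cubic lattice `cℤ³` are integer multiples of `c`. -/
theorem exists_int_coord_of_mem_cubicLattice (c : ℝˣ) {v : E3} (hv : v ∈ cubicLattice c)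
    (j : Fin 3) : ∃ n : ℤ, v j = (c : ℝ) * n := by
  induction hv using Submodule.span_induction generalizing j with
  | mem v hv =>
    obtain ⟨i, rfl⟩ := hv
    rw [cubicBasis_apply]
    by_cases hji : j = i
    · subst hji; exact ⟨1, by simp⟩
    · exact ⟨0, by simp [hji]⟩
  | zero => exact ⟨0, by simp⟩
  | add u w _ _ hu hw =>
    obtain ⟨n, hn⟩ := hu j
    obtain ⟨m, hm⟩ := hw j
    exact ⟨n + m, by simp [hn, hm, mul_add]⟩
  | smul a u _ hu =>
    obtain ⟨n, hn⟩ := hu j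
    exact ⟨a * n, by simp [hn]; ring⟩

/-- Non-zero vectors of `cℤ³` (`c > 0`) have norm `≥ c`. -/
theorem le_norm_of_mem_cubicLattice {c : ℝˣ} (hc : 0 < (c : ℝ)) {v : E3}
    (hv : v ∈ cubicLattice c) (hv0 : v ≠ 0) : (c : ℝ) ≤ ‖v‖ := by
  have hex : ∃ j, v j ≠ 0 := by
    by_contra hall
    push Not at hall
    exact hv0 (PiLp.ext fun j => by simpa using hall j)
  obtain ⟨j, hj⟩ := hex
  obtain ⟨n, hn⟩ := exists_int_coord_of_mem_cubicLattice c hv j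
  have hn0 : n ≠ 0 := by
    rintro rfl
    simp at hn
    exact hj hn
  have hn1 : (1 : ℝ) ≤ |(n : ℝ)| := by
    rw [← Int.cast_abs]; exact_mod_cast Int.one_le_abs hn0
  have hcoord : |v j| ≤ ‖v‖ := by
    have := PiLp.norm_apply_le v j
    simpa using this
  calc (c : ℝ) ≤ (c : ℝ) * |(n : ℝ)| := le_mul_of_one_le_right hc.le hn1
    _ = |v j| := by rw [hn, abs_mul, abs_of_pos hc]
    _ ≤ ‖v‖ := hcoord

/-- **Periodisation** of a configuration of `N ≥ 1` points of `ℝ³` with the cubic lattice `cℤ³`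
of any period `c ≥ L = 2Σ‖xᵢ‖ + 2` (motif `= {xᵢ}`; distinct motif points differ by less than
`c`, the length of the shortest non-zero period). -/
def periodise (c : ℝˣ) (hc : period x ≤ (c : ℝ)) (hN : 0 < N) : PeriodicConfiguration 3 where
  lattice := cubicLattice c
  discrete := inferInstance
  isZLattice := inferInstance
  motif := Finset.univ.image x
  motif_nonempty := by
    haveI : Nonempty (Fin N) := ⟨⟨0, hN⟩⟩
    exact Finset.univ_nonempty.image x
  eq_of_sub_mem := by
    intro p hp q hq hpq
    obtain ⟨i, -, rfl⟩ := Finset.mem_image.1 hp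
    obtain ⟨j, -, rfl⟩ := Finset.mem_image.1 hq
    by_contra hne
    have hcpos : 0 < (c : ℝ) := lt_of_lt_of_le (period_pos x) hc
    have h1 := le_norm_of_mem_cubicLattice hcpos hpq (sub_ne_zero.2 hne)
    have h2 : ‖x i - x j‖ ≤ 2 * Dsum x := by rw [← dist_eq_norm]; exact dist_le_two_Dsum x i j
    unfold period at hc
    linarith

/-- The motif of the periodisation is `{xᵢ}`. -/
theorem motif_periodise (c : ℝˣ) (hc : period x ≤ (c : ℝ)) (hN : 0 < N) :
    (periodise x c hc hN).motif = Finset.univ.image x := rfl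

/-- Points of the periodisation other than the `xⱼ` themselves are at distance `≥ c − 2D ≥ 2`
from every `xᵢ` (a non-zero period has length `≥ c`). -/
theorem sub_le_dist_of_mem_points (c : ℝˣ) (hc : period x ≤ (c : ℝ)) (hN : 0 < N) (i : Fin N)
    {y : E3} (hy : y ∈ (periodise x c hc hN).points) (hyx : ∀ j, y ≠ x j) :
    (c : ℝ) - 2 * Dsum x ≤ dist (x i) y := by
  obtain ⟨z, hz, g, hg, rfl⟩ := hy
  rw [motif_periodise] at hz
  obtain ⟨j, -, rfl⟩ := Finset.mem_image.1 hz
  have hg0 : g ≠ 0 := by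
    rintro rfl
    exact hyx j (by simp)
  have hcpos : 0 < (c : ℝ) := lt_of_lt_of_le (period_pos x) hc
  have hL : (c : ℝ) ≤ ‖g‖ := le_norm_of_mem_cubicLattice hcpos hg hg0
  rw [dist_eq_norm]
  have h1 : ‖g‖ - ‖x i - x j‖ ≤ ‖x i - (x j + g)‖ := by
    rw [show x i - (x j + g) = (x i - x j) - g by abel, ← norm_neg ((x i - x j) - g), neg_sub]
    exact norm_sub_norm_le g (x i - x j)
  have h2 : ‖x i - x j‖ ≤ 2 * Dsum x := by rw [← dist_eq_norm]; exact dist_le_two_Dsum x i j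
  linarith

/-- In particular they are at distance `≥ 2`. -/
theorem two_le_dist_of_mem_points (c : ℝˣ) (hc : period x ≤ (c : ℝ)) (hN : 0 < N) (i : Fin N)
    {y : E3} (hy : y ∈ (periodise x c hc hN).points) (hyx : ∀ j, y ≠ x j) : 2 ≤ dist (x i) y := by
  have := sub_le_dist_of_mem_points x c hc hN i hy hyx
  unfold period at hc
  linarith

variable {x}

/-- The lattice sum at `xᵢ` over the periodisation is at most the finite site energy
`∑_{k ≠ i} V_LJ(|xᵢ − x_k|)`: the remaining terms are `≤ 0`. -/
theorem tsum_le_siteEnergy (hx : Function.Injective x) (c : ℝˣ) (hc : period x ≤ (c : ℝ))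
    (hN : 0 < N) (i : Fin N) :
    (∑' y : {y : E3 // y ∈ (periodise x c hc hN).points ∧ y ≠ x i},
        lennardJones (dist (x i) y.1)) ≤ siteEnergy lennardJones x i := by
  set P := periodise x c hc hN with hP
  set f : {y : E3 // y ∈ P.points ∧ y ≠ x i} → ℝ := fun y => lennardJones (dist (x i) y.1)
    with hf
  have hsum : Summable f := P.summable_lennardJones_dist_three (x i)
  have hmem : ∀ k : {k // k ∈ Finset.univ.erase i}, x k.1 ∈ P.points ∧ x k.1 ≠ x i := fun k =>
    ⟨P.mem_points_of_mem_motif (by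
        rw [hP, motif_periodise]; exact Finset.mem_image_of_mem x (Finset.mem_univ _)),
      hx.ne (Finset.ne_of_mem_erase k.2)⟩
  set emb : {k // k ∈ Finset.univ.erase i} → {y : E3 // y ∈ P.points ∧ y ≠ x i} :=
    fun k => ⟨x k.1, hmem k⟩ with hemb
  have hinj : Function.Injective emb := by
    intro k l hkl
    have h1 : x k.1 = x l.1 := congrArg Subtype.val hkl
    exact Subtype.ext (hx h1)
  set s₀ : Finset {y : E3 // y ∈ P.points ∧ y ≠ x i} := (Finset.univ.erase i).attach.image emb
    with hs₀
  have hsign : ∀ y ∉ s₀, 0 ≤ (fun b => -f b) y := by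
    intro y hy
    have hfar : ∀ j, y.1 ≠ x j := by
      intro j hj
      by_cases hji : j = i
      · exact y.2.2 (hji ▸ hj)
      · exact hy (Finset.mem_image.2 ⟨⟨j, Finset.mem_erase.2 ⟨hji, Finset.mem_univ j⟩⟩,
          Finset.mem_attach _ _, Subtype.ext hj.symm⟩)
    have h1 := two_le_dist_of_mem_points x c hc hN i y.2.1 hfar
    simp only [hf, neg_nonneg]
    exact lennardJones_nonpos (by linarith)
  have h1 := sum_le_hasSum s₀ hsign hsum.hasSum.neg
  have h2 : ∑ y ∈ s₀, f y = siteEnergy lennardJones x i := by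
    rw [hs₀, Finset.sum_image fun k _ l _ h => hinj h]
    exact Finset.sum_attach (Finset.univ.erase i) fun k => lennardJones (dist (x i) (x k))
  rw [Finset.sum_neg_distrib, h2] at h1
  linarith

/-- Hence `e(periodisation of x) ≤ E_LJ(x)/N`. -/
theorem energyPerParticle_periodise_le (hx : Function.Injective x) (c : ℝˣ)
    (hc : period x ≤ (c : ℝ)) (hN : 0 < N) :
    (periodise x c hc hN).energyPerParticle lennardJones ≤
      interactionEnergy lennardJones x / N := by
  have hcard : (periodise x c hc hN).motif.card = N := by
    rw [motif_periodise, Finset.card_image_of_injective _ hx, Finset.card_univ, Fintype.card_fin]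
  have hNr : (0 : ℝ) < N := by exact_mod_cast hN
  unfold PeriodicConfiguration.energyPerParticle
  rw [hcard]
  have hsum : ∑ z ∈ (periodise x c hc hN).motif,
      ∑' y : {y : E3 // y ∈ (periodise x c hc hN).points ∧ y ≠ z}, lennardJones (dist z y.1) ≤
        ∑ i, siteEnergy lennardJones x i := by
    rw [motif_periodise, Finset.sum_image fun i _ j _ h => hx h]
    exact Finset.sum_le_sum fun i _ => tsum_le_siteEnergy hx c hc hN i
  rw [← two_mul_interactionEnergy] at hsum
  calc (2 * (N : ℝ))⁻¹ * ∑ z ∈ (periodise x c hc hN).motif,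
        ∑' y : {y : E3 // y ∈ (periodise x c hc hN).points ∧ y ≠ z}, lennardJones (dist z y.1)
      ≤ (2 * (N : ℝ))⁻¹ * (2 * interactionEnergy lennardJones x) :=
        mul_le_mul_of_nonneg_left hsum (by positivity)
    _ = interactionEnergy lennardJones x / N := by
        field_simp

end Periodise

/-- **`N·e* ≤ E_LJ(y)` for every injective configuration** (given that `e*` is the genuine
infimum, item 0714): the `κ = 0`, `C = 0` instance of the crux. -/
theorem card_mul_eStar_le_interactionEnergy
    (hB : BddBelow (Set.range fun Q : PeriodicConfiguration 3 => Q.energyPerParticle lennardJones))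
    {N : ℕ} {x : Fin N → E3} (hx : Function.Injective x) :
    (N : ℝ) * eStar ≤ interactionEnergy lennardJones x := by
  rcases Nat.eq_zero_or_pos N with rfl | hN
  · simp [interactionEnergy]
  · have h1 : eStar ≤ (periodise x (periodUnit x) le_rfl hN).energyPerParticle lennardJones :=
      ciInf_le hB _
    have h2 := energyPerParticle_periodise_le hx (periodUnit x) le_rfl hN
    have hNr : (0 : ℝ) < N := by exact_mod_cast hN
    have := h1.trans h2
    rwa [le_div_iff₀ hNr, mul_comm] at this

/-- **The `κ = 0` gap is TRUE (with `C = 0`) iff item 0714 holds.**  (`→`: by periodisation;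
`←`: in the junk world `e* = 0` and the dimer has energy `−1/12 < 0 = N·e*`.) -/
theorem gapWith_zero_zero_iff (η : ℝ) :
    GapWith η 0 0 ↔
      BddBelow (Set.range fun Q : PeriodicConfiguration 3 => Q.energyPerParticle lennardJones) := by
  constructor
  · intro h
    by_contra hb
    have h0 : eStar = 0 := Real.iInf_of_not_bddBelow hb
    have := h 2 dimer dimer_injective
    rw [interactionEnergy_dimer, h0] at this
    norm_num at this
  · intro hB N y hy
    have := card_mul_eStar_le_interactionEnergy hB hy
    simpa using this

/-- Hence, granted 0714, the crux is EQUIVALENT to its pure pricing content: a uniform price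
`κ > 0` per charged site on the (non-negative) excess `E_LJ(y) − N·e*`. -/
theorem chargedEnergyGap_iff_pricing :
    ChargedEnergyGap ↔
      BddBelow (Set.range fun Q : PeriodicConfiguration 3 => Q.energyPerParticle lennardJones) ∧
      ∃ κ : ℝ, 0 < κ ∧ ∀ (N : ℕ) (y : Fin N → E3), Function.Injective y →
        κ * (charged (1 / 100) y : ℝ) ≤ interactionEnergy lennardJones y - (N : ℝ) * eStar := by
  rw [chargedEnergyGap_iff_noBoundary]
  constructor
  · rintro ⟨κ, hκ, h⟩
    refine ⟨?_, κ, hκ, fun N y hy => by linarith [h N y hy]⟩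
    exact bddBelow_of_chargedEnergyGap
      (chargedEnergyGap_iff_noBoundary.2 ⟨κ, hκ, h⟩)
  · rintro ⟨-, κ, hκ, h⟩
    exact ⟨κ, hκ, fun N y hy => by linarith [h N y hy]⟩

/-- **A refutation witness is a near-minimiser with dense charge.**  If `y` violates the price `κ`
(the shape required by `not_gapWith_of_witness`), then — granted 0714 — its excess energy is
squeezed: `0 ≤ E(y) − N·e* < κ·#charged(y) ≤ κ·N`.  Certifying such a witness in Lean needs
`e*` from BELOW to precision `κ` per particle, i.e. a sharp lower bound on the periodic
minimum along an explicit family. -/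
theorem nearMinimiser_of_violation
    (hB : BddBelow (Set.range fun Q : PeriodicConfiguration 3 => Q.energyPerParticle lennardJones))
    {η κ : ℝ} {N : ℕ} {y : Fin N → E3} (hy : Function.Injective y)
    (hlt : interactionEnergy lennardJones y < (N : ℝ) * eStar + κ * (charged η y : ℝ)) :
    0 ≤ interactionEnergy lennardJones y - (N : ℝ) * eStar ∧
      interactionEnergy lennardJones y - (N : ℝ) * eStar < κ * (charged η y : ℝ) ∧
      (charged η y : ℝ) ≤ N := by
  refine ⟨by linarith [card_mul_eStar_le_interactionEnergy hB hy], by linarith, ?_⟩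
  unfold charged
  exact_mod_cast (Finite.card_subtype_le _).trans_eq (Nat.card_fin N)


/-! ## §5. Tightness of the shape: linear allowance is trivial; injectivity is load-bearing -/

section Shape

/-- A constant configuration has zero Lennard-Jones energy (`V_LJ(0) = 0`, Lean's `0⁻¹ = 0`). -/
theorem interactionEnergy_const (N : ℕ) (c : E3) :
    interactionEnergy lennardJones (fun _ : Fin N => c) = 0 := by
  unfold interactionEnergy
  simp [lennardJones_zero]

/-- **With a LINEAR allowance `C·N` the priced gap is trivially true** (unconditionally, even
with price `κ = 1`): `#charged ≤ N`, `E_LJ ≥ −(2³²/12)·N` (finite stability, tree), and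
`e* ≤ max 0 e(Q₀)` for any fixed periodic `Q₀` (genuine infimum or junk `0`).  So the content
of the crux sits exactly in the SUBLINEAR allowance `N^(2/3)` — equivalently (§3) in no
allowance at all. -/
theorem gapWith_linear_allowance :
    ∃ κ C : ℝ, 0 < κ ∧ ∀ (N : ℕ) (y : Fin N → E3), Function.Injective y →
      (N : ℝ) * eStar + κ * (charged (1 / 100) y : ℝ) - C * (N : ℝ) ≤
        interactionEnergy lennardJones y := by
  set Q₀ : PeriodicConfiguration 3 := periodise dimer (periodUnit dimer) le_rfl (by norm_num : 0 < 2)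
    with hQ₀
  refine ⟨1, 1 + max 0 (Q₀.energyPerParticle lennardJones) + 65536 ^ 2 / 12, one_pos, ?_⟩
  intro N y hy
  have hE : -((65536 ^ 2 / 12 : ℝ) * N) ≤ interactionEnergy lennardJones y :=
    le_interactionEnergy_lennardJones (by norm_num) N y hy
  have hch : (charged (1 / 100) y : ℝ) ≤ N := by
    unfold charged
    exact_mod_cast (Finite.card_subtype_le _).trans_eq (Nat.card_fin N)
  have he : eStar ≤ max 0 (Q₀.energyPerParticle lennardJones) := by
    by_cases hB : BddBelow (Set.range fun Q : PeriodicConfiguration 3 =>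
        Q.energyPerParticle lennardJones)
    · exact (ciInf_le hB Q₀).trans (le_max_right _ _)
    · rw [show eStar = 0 from Real.iInf_of_not_bddBelow hB]
      exact le_max_left _ _
  have hN0 : (0 : ℝ) ≤ N := Nat.cast_nonneg N
  have h1 : (N : ℝ) * eStar ≤ (N : ℝ) * max 0 (Q₀.energyPerParticle lennardJones) :=
    mul_le_mul_of_nonneg_left he hN0
  nlinarith

/-- The crux with the hypothesis `Function.Injective y` DROPPED. -/
def GapNonInj (η κ C : ℝ) : Prop :=
  ∀ (N : ℕ) (y : Fin N → E3),
    (N : ℝ) * eStar + κ * (charged η y : ℝ) - C * (N : ℝ) ^ (2 / 3 : ℝ) ≤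
      interactionEnergy lennardJones y

/-- The pile-up `k` particles at `0` and `k` particles at `e₀` (not injective for `k ≥ 2`). -/
def pile (k : ℕ) : Fin (k + k) → E3 :=
  Fin.append (fun _ : Fin k => (0 : E3)) (fun _ : Fin k => e0)

/-- `E(pile k) = −k²/12`: the `k²` cross pairs sit at the potential minimum, coincident pairs
contribute `V_LJ(0) = 0`. -/
theorem interactionEnergy_pile (k : ℕ) :
    interactionEnergy lennardJones (pile k) = -((k : ℝ) ^ 2 / 12) := by
  unfold pile
  rw [interactionEnergy_append lennardJones lennardJones_zero, interactionEnergy_const,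
    interactionEnergy_const]
  simp only [dist_zero_left, norm_e0, lennardJones_one, Finset.sum_const, Finset.card_univ,
    Fintype.card_fin, nsmul_eq_mul]
  ring

/-- **Injectivity is load-bearing**: without it the inequality fails for EVERY `η`, `κ`, `C`
(the pile-up has energy `−k²/12`, quadratic in `N = 2k`, against a left side `≥ −O(N)`).
Any proof of the crux must use `Function.Injective y` (it is the only hypothesis on `y`). -/
theorem not_gapNonInj (η κ C : ℝ) : ¬ GapNonInj η κ C := by
  intro h
  -- a large `k`
  obtain ⟨k₀, hk₀⟩ := exists_nat_gt (24 * (|κ| + |C| + |eStar|))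
  set k := k₀ + 1 with hk
  have hk1 : (1 : ℝ) ≤ k := by simp [hk]
  have hkpos : (0 : ℝ) < k := by linarith
  have hk₀' : 24 * (|κ| + |C| + |eStar|) < k := by
    have : (k₀ : ℝ) ≤ k := by simp [hk]
    linarith
  have hg := h (k + k) (pile k)
  rw [interactionEnergy_pile] at hg
  push_cast at hg
  -- bounds on the three left-hand terms
  have hch : (charged η (pile k) : ℝ) ≤ k + k := by
    unfold charged
    exact_mod_cast (Finite.card_subtype_le _).trans_eq (Nat.card_fin (k + k))
  have hch0 : (0 : ℝ) ≤ (charged η (pile k) : ℝ) := Nat.cast_nonneg _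
  have hA0 : (0 : ℝ) ≤ ((k : ℝ) + k) ^ (2 / 3 : ℝ) := Real.rpow_nonneg (by linarith) _
  have hA : ((k : ℝ) + k) ^ (2 / 3 : ℝ) ≤ (k : ℝ) + k := by
    have h1 : (1 : ℝ) ≤ (k : ℝ) + k := by linarith
    calc ((k : ℝ) + k) ^ (2 / 3 : ℝ) ≤ ((k : ℝ) + k) ^ (1 : ℝ) :=
          Real.rpow_le_rpow_of_exponent_le h1 (by norm_num)
      _ = (k : ℝ) + k := Real.rpow_one _
  have h1 : -(|κ| * (k + k)) ≤ κ * (charged η (pile k) : ℝ) := by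
    have := neg_abs_le (κ * (charged η (pile k) : ℝ))
    rw [abs_mul, abs_of_nonneg hch0] at this
    nlinarith [abs_nonneg κ]
  have h2 : -(|C| * (k + k)) ≤ -(C * ((k : ℝ) + k) ^ (2 / 3 : ℝ)) := by
    have := le_abs_self (C * ((k : ℝ) + k) ^ (2 / 3 : ℝ))
    rw [abs_mul, abs_of_nonneg hA0] at this
    nlinarith [abs_nonneg C]
  have h3 : -(|eStar| * (k + k)) ≤ ((k : ℝ) + k) * eStar := by
    have := neg_abs_le (((k : ℝ) + k) * eStar)
    rw [abs_mul, abs_of_nonneg (by linarith : (0 : ℝ) ≤ k + k)] at this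
    linarith
  -- so `k²/12 ≤ 2k(|κ| + |C| + |e*|)`, i.e. `k ≤ 24(|κ| + |C| + |e*|)`: contradiction
  have h4 : (k : ℝ) ^ 2 / 12 ≤ (k + k) * (|κ| + |C| + |eStar|) := by nlinarith
  have h5 : (k : ℝ) ≤ 24 * (|κ| + |C| + |eStar|) := by
    rw [pow_two] at h4
    have : (k : ℝ) * (k - 24 * (|κ| + |C| + |eStar|)) ≤ 0 := by nlinarith
    nlinarith
  linarith

end Shape


/-! ## §6. The tolerance is load-bearing: with `η ≤ 0` the priced gap is FALSE

(granted that finite configurations approach the periodic infimum from above — hypothesis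
`hTS` below, a consequence of the route's own support item `CrysEnergyUpper` (stmt 11865) proved
here, and proved OUTRIGHT in the companion module `…Negative.BlocksBound` (`exists_trialState`).)
With `η < 0` no bond exists at all (a bond at `j` would be shorter than `nn_j`), so EVERY site
of EVERY configuration is charged and the gap would say `N(e* + κ) ≤ E(y)` for all `y`;
with `η = 0` the same holds for every configuration whose distances from each site are pairwise
distinct — a generic (dense) condition reached from any `y` by an arbitrarily small explicit
perturbation — so near-optimal trial states, slightly perturbed, are fully charged at cost `→ 0`.
-/

section Tolerance

/-! `TrialStates` (used as an explicit hypothesis below, and PROVED in the companion module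
`…Negative.BlocksBound`, `exists_trialState`): finite injective configurations approach `e*` from
above, `∀ δ > 0, ∃ N ≥ 1, ∃ y injective, E_LJ(y) < N(e* + δ)`. -/

/-- `E(N) ≤ 0` for Lennard-Jones ground-state energies (subadditivity with `E(0) = E(1) = 0`). -/
theorem groundStateEnergy_nonpos (N : ℕ) : groundStateEnergy lennardJones 3 N ≤ 0 := by
  have hsub := subadditive_groundStateEnergy_lennardJones (by norm_num : 0 < 3)
  have h := hsub.apply_mul_add_le N 1 0
  simp only [mul_one, add_zero] at h
  have h1 : groundStateEnergy lennardJones 3 1 = 0 := groundStateEnergy_of_le_one _ le_rfl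
  have h0 : groundStateEnergy lennardJones 3 0 = 0 := groundStateEnergy_of_le_one _ (by norm_num)
  rw [h1, h0] at h
  simpa using h

/-- **`CrysEnergyUpper → TrialStates`**: from `limsup E(N)/N ≤ e*` (the sequence is bounded above
by `0`) some `E(N)/N < e* + δ`, and `E(N)` is an infimum over injective configurations. -/
theorem trialStates_of_crysEnergyUpper (h : CrysEnergyUpper) :
    ∀ δ : ℝ, 0 < δ → ∃ (N : ℕ) (y : Fin N → E3), 0 < N ∧ Function.Injective y ∧
      interactionEnergy lennardJones y < (N : ℝ) * (eStar + δ) := by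
  intro δ hδ
  have hlt : Filter.limsup (fun N : ℕ => groundStateEnergy lennardJones 3 N / N) Filter.atTop <
      eStar + δ := lt_of_le_of_lt h (by unfold eStar; linarith)
  have hbdd : Filter.IsBoundedUnder (· ≤ ·) Filter.atTop
      (fun N : ℕ => groundStateEnergy lennardJones 3 N / N) := by
    refine Filter.isBoundedUnder_of ⟨0, fun N => ?_⟩
    rcases Nat.eq_zero_or_pos N with rfl | hN
    · simp
    · exact div_nonpos_iff.2 (Or.inr ⟨groundStateEnergy_nonpos N, Nat.cast_nonneg N⟩)
  have hev := Filter.eventually_lt_of_limsup_lt hlt hbdd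
  obtain ⟨N, hNlt, hN1⟩ := (hev.and (Filter.eventually_ge_atTop 1)).exists
  have hN : (0 : ℝ) < N := by exact_mod_cast hN1
  rw [div_lt_iff₀ hN] at hNlt
  haveI := nonempty_injective_config (by norm_num : 0 < 3) N
  obtain ⟨⟨y, hy⟩, hylt⟩ := exists_lt_of_ciInf_lt
    (f := fun x : {x : Fin N → E3 // Function.Injective x} => interactionEnergy lennardJones x.1)
    hNlt
  exact ⟨N, y, hN1, hy, by simpa [mul_comm] using hylt⟩

/-- With a NEGATIVE tolerance there are no bonds at all (a bond `{j, k}` would have length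
`≤ (1 + η)·min(nn_j, nn_k) < min(nn_j, nn_k) ≤ dist`), for injective configurations. -/
theorem not_adj_of_eta_neg {η : ℝ} (hη : η < 0) {N : ℕ} {y : Fin N → E3}
    (hy : Function.Injective y) (j k : Fin N) : ¬ (bondGraph η y).Adj j k := by
  intro h
  obtain ⟨hne, hle⟩ := bondGraph_adj.1 h
  have hpos : 0 < dist (y j) (y k) := dist_pos.2 (hy.ne hne)
  have hm : min (nearestDist y j) (nearestDist y k) ≤ dist (y j) (y k) :=
    (min_le_left _ _).trans (nearestDist_le_dist y hne.symm)
  have hm0 : 0 ≤ min (nearestDist y j) (nearestDist y k) :=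
    le_min (nearestDist_nonneg _ _) (nearestDist_nonneg _ _)
  rcases hm0.eq_or_lt with hm0' | hmpos
  · rw [← hm0', mul_zero] at hle
    linarith
  · have : (1 + η) * min (nearestDist y j) (nearestDist y k) <
        min (nearestDist y j) (nearestDist y k) := by nlinarith
    linarith

/-- Hence with `η < 0` every site of an injective configuration is charged. -/
theorem charged_eq_of_eta_neg {η : ℝ} (hη : η < 0) {N : ℕ} {y : Fin N → E3}
    (hy : Function.Injective y) : charged η y = N := by
  unfold charged
  have h : ∀ i : Fin N, ¬ IsChargeFree η y i := fun i hcf => by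
    have hempty : (bondGraph η y).neighborSet i = ∅ := by
      ext k
      simp only [SimpleGraph.mem_neighborSet, Set.mem_empty_iff_false, iff_false]
      exact not_adj_of_eta_neg hη hy i k
    have := hcf.1
    rw [hempty, Set.ncard_empty] at this
    exact absurd this (by norm_num)
  rw [Nat.card_congr (Equiv.subtypeUnivEquiv h), Nat.card_eq_fintype_card, Fintype.card_fin]

/-- **`η < 0` kills the gap** (given `TrialStates`): `N(e* + κ) ≤ E(y)` for all `y` is absurd. -/
theorem not_gapWith_of_eta_neg
    (hTS : ∀ δ : ℝ, 0 < δ → ∃ (N : ℕ) (y : Fin N → E3), 0 < N ∧ Function.Injective y ∧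
      interactionEnergy lennardJones y < (N : ℝ) * (eStar + δ))
    {η κ : ℝ} (hη : η < 0) (hκ : 0 < κ) (C : ℝ) : ¬ GapWith η κ C := by
  intro h
  have hnb := noBoundary_of_gapWith (by linarith) h
  obtain ⟨N, y, -, hy, hlt⟩ := hTS κ hκ
  have := hnb N y hy
  rw [charged_eq_of_eta_neg hη hy] at this
  linarith

/-! ### `η = 0`: generic configurations are fully charged -/

/-- Zeros of a genuine quadratic form a finite set. -/
theorem finite_quadratic_zeros {A B C : ℝ} (hC : C ≠ 0) :
    {t : ℝ | A + B * t + C * t ^ 2 = 0}.Finite := by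
  set p : Polynomial ℝ := Polynomial.C C * Polynomial.X ^ 2 + Polynomial.C B * Polynomial.X +
    Polynomial.C A with hp_def
  have hp : p ≠ 0 := by
    intro h0
    have h2 : p.coeff 2 = C := by
      simp [hp_def, Polynomial.coeff_X_pow]
    rw [h0, Polynomial.coeff_zero] at h2
    exact hC h2.symm
  refine (p.roots.toFinset.finite_toSet).subset fun t ht => ?_
  simp only [Set.mem_setOf_eq] at ht
  rw [Finset.mem_coe, Multiset.mem_toFinset, Polynomial.mem_roots hp, Polynomial.IsRoot.def]
  simp only [hp_def, Polynomial.eval_add, Polynomial.eval_mul, Polynomial.eval_C,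
    Polynomial.eval_pow, Polynomial.eval_X]
  linarith

/-- In `ℕ`: `4ʲ + 4ᵏ ≠ 2·4ⁱ` whenever `j ≠ i` and `k ≠ i`. -/
theorem four_pow_add_ne {i j k : ℕ} (hj : j ≠ i) (hk : k ≠ i) : 4 ^ j + 4 ^ k ≠ 2 * 4 ^ i := by
  intro h
  have h4 : (0 : ℕ) < 4 ^ j := by positivity
  have h4' : (0 : ℕ) < 4 ^ k := by positivity
  rcases lt_or_gt_of_ne hj with hj | hj <;> rcases lt_or_gt_of_ne hk with hk | hk
  · have h1 : 4 ^ j ≤ 4 ^ (i - 1) := Nat.pow_le_pow_right (by norm_num) (by omega)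
    have h2 : 4 ^ k ≤ 4 ^ (i - 1) := Nat.pow_le_pow_right (by norm_num) (by omega)
    have h3 : 4 ^ i = 4 * 4 ^ (i - 1) := by
      rw [← pow_succ']; congr 1; omega
    omega
  · have h2 : 4 ^ (i + 1) ≤ 4 ^ k := Nat.pow_le_pow_right (by norm_num) (by omega)
    rw [pow_succ] at h2; omega
  · have h2 : 4 ^ (i + 1) ≤ 4 ^ j := Nat.pow_le_pow_right (by norm_num) (by omega)
    rw [pow_succ] at h2; omega
  · have h2 : 4 ^ (i + 1) ≤ 4 ^ j := Nat.pow_le_pow_right (by norm_num) (by omega)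
    rw [pow_succ] at h2; omega

variable {N : ℕ}

/-- Perturbation weights `wᵢ = 4ⁱ`. -/
def wt (i : Fin N) : ℝ := (4 : ℝ) ^ (i : ℕ)

/-- `wᵢ` is the cast of the natural number `4ⁱ`. -/
theorem wt_eq_cast (i : Fin N) : wt i = ((4 ^ (i : ℕ) : ℕ) : ℝ) := by simp [wt]

/-- The weights are pairwise distinct. -/
theorem wt_injective : Function.Injective (wt (N := N)) := by
  intro i j h
  rw [wt_eq_cast, wt_eq_cast] at h
  have h' : 4 ^ (i : ℕ) = 4 ^ (j : ℕ) := by exact_mod_cast h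
  exact Fin.ext (Nat.pow_right_injective (by norm_num : 2 ≤ 4) h')

/-- The squared coefficients `(wᵢ − wⱼ)²`, `j ≠ i`, are pairwise distinct. -/
theorem wt_sq_sub_ne {i j k : Fin N} (hj : j ≠ i) (hk : k ≠ i) (hjk : j ≠ k) :
    (wt i - wt j) ^ 2 - (wt i - wt k) ^ 2 ≠ 0 := by
  intro h
  have h' : (wt j - wt k) * (wt j + wt k - 2 * wt i) = 0 := by linear_combination h
  rcases mul_eq_zero.1 h' with h1 | h1
  · exact hjk (wt_injective (sub_eq_zero.1 h1))
  · have h2 : 4 ^ (j : ℕ) + 4 ^ (k : ℕ) = 2 * 4 ^ (i : ℕ) := by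
      rw [wt_eq_cast, wt_eq_cast, wt_eq_cast] at h1
      exact_mod_cast (by linarith : ((4 ^ (j : ℕ) : ℕ) : ℝ) + ((4 ^ (k : ℕ) : ℕ) : ℝ) =
        2 * ((4 ^ (i : ℕ) : ℕ) : ℝ))
    exact four_pow_add_ne (Fin.val_ne_of_ne hj) (Fin.val_ne_of_ne hk) h2

variable (y : Fin N → E3)

/-- The explicit perturbation `yᵢ + t·4ⁱ·e₀`. -/
def pert (t : ℝ) : Fin N → E3 := fun i => y i + (t * wt i) • e0

/-- At `t = 0` the perturbation is the identity. -/
@[simp] theorem pert_zero : pert y 0 = y := by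
  funext i; simp [pert]

/-- Differences of perturbed points. -/
theorem pert_sub (t : ℝ) (i j : Fin N) :
    pert y t i - pert y t j = (y i - y j) + (t * (wt i - wt j)) • e0 := by
  simp only [pert, mul_sub, sub_smul]
  abel

/-- Squared perturbed distances are explicit quadratics in `t`. -/
theorem dist_pert_sq (t : ℝ) (i j : Fin N) :
    dist (pert y t i) (pert y t j) ^ 2 =
      ‖y i - y j‖ ^ 2 + 2 * (t * (wt i - wt j)) * inner ℝ (y i - y j) e0 +
        (t * (wt i - wt j)) ^ 2 := by
  rw [dist_eq_norm, pert_sub, norm_add_sq_real, real_inner_smul_right, norm_smul, norm_e0,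
    mul_one, Real.norm_eq_abs, sq_abs]
  ring

/-- For a triple of distinct indices, the perturbed distances `|i j|`, `|i k|` agree only at
the zeros of a genuine quadratic in `t`: finitely many `t`. -/
theorem finite_bad_triple (i j k : Fin N) :
    {t : ℝ | j ≠ i ∧ k ≠ i ∧ j ≠ k ∧
      dist (pert y t i) (pert y t j) = dist (pert y t i) (pert y t k)}.Finite := by
  by_cases hc : j ≠ i ∧ k ≠ i ∧ j ≠ k
  · obtain ⟨hj, hk, hjk⟩ := hc
    refine (finite_quadratic_zeros (A := ‖y i - y j‖ ^ 2 - ‖y i - y k‖ ^ 2)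
      (B := 2 * (wt i - wt j) * inner ℝ (y i - y j) e0 - 2 * (wt i - wt k) * inner ℝ (y i - y k) e0)
      (wt_sq_sub_ne hj hk hjk)).subset ?_
    rintro t ⟨-, -, -, ht⟩
    have h2 : dist (pert y t i) (pert y t j) ^ 2 = dist (pert y t i) (pert y t k) ^ 2 := by
      rw [ht]
    rw [dist_pert_sq, dist_pert_sq] at h2
    simp only [Set.mem_setOf_eq]
    linear_combination h2
  · refine Set.finite_empty.subset ?_
    rintro t ⟨hj, hk, hjk, -⟩
    exact (hc ⟨hj, hk, hjk⟩).elim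

/-- Two distinct sites collide for at most one value of `t`. -/
theorem finite_bad_pair (i j : Fin N) : {t : ℝ | i ≠ j ∧ pert y t i = pert y t j}.Finite := by
  by_cases hij : i = j
  · refine Set.finite_empty.subset ?_
    rintro t ⟨h, -⟩
    exact (h hij).elim
  · apply Set.Subsingleton.finite
    rintro t ⟨-, ht⟩ t' ⟨-, ht'⟩
    have e1 : (y i - y j) + (t * (wt i - wt j)) • e0 = 0 := by
      rw [← pert_sub, sub_eq_zero]; exact ht
    have e2 : (y i - y j) + (t' * (wt i - wt j)) • e0 = 0 := by
      rw [← pert_sub, sub_eq_zero]; exact ht'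
    have h1 : ((t - t') * (wt i - wt j)) • e0 = 0 := by
      have : (t * (wt i - wt j)) • e0 - (t' * (wt i - wt j)) • e0 = 0 := by
        have h := congrArg₂ (· - ·) e1 e2
        simpa using h
      rw [← sub_smul] at this
      convert this using 2
      ring
    rcases smul_eq_zero.1 h1 with h2 | h2
    · rcases mul_eq_zero.1 h2 with h3 | h3
      · linarith
      · exact absurd (wt_injective (sub_eq_zero.1 h3)) hij
    · exact absurd h2 e0_ne_zero

/-- The energy of the perturbed configuration depends continuously on `t` at `t = 0`
(all distances are non-zero there, where `V_LJ` is continuous). -/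
theorem tendsto_energy_pert (hy : Function.Injective y) :
    Filter.Tendsto (fun t => interactionEnergy lennardJones (pert y t)) (nhds 0)
      (nhds (interactionEnergy lennardJones y)) := by
  have h0 : interactionEnergy lennardJones y = interactionEnergy lennardJones (pert y 0) := by
    rw [pert_zero]
  rw [h0]
  unfold interactionEnergy
  refine tendsto_finsetSum _ fun i _ => tendsto_finsetSum _ fun j hj => ?_
  have hne : y i ≠ y j := hy.ne (Finset.mem_Ioi.1 hj).ne
  have hcont : Continuous fun t : ℝ => dist (pert y t i) (pert y t j) := by
    simp only [pert]
    fun_prop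
  have hd0 : dist (pert y 0 i) (pert y 0 j) ∈ ({0}ᶜ : Set ℝ) := by
    rw [pert_zero]; exact dist_ne_zero.2 hne
  exact ((continuousOn_lennardJones.continuousAt (isOpen_compl_singleton.mem_nhds hd0)).tendsto).comp
    (hcont.tendsto 0)

/-- **Generic perturbation.** Every injective configuration admits, at arbitrarily small energy
cost, an injective perturbation in which the distances from each site to the others are
pairwise distinct. -/
theorem exists_pert (hy : Function.Injective y) {ε : ℝ} (hε : 0 < ε) :
    ∃ t : ℝ, Function.Injective (pert y t) ∧
      (∀ i j k : Fin N, j ≠ i → k ≠ i → j ≠ k →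
        dist (pert y t i) (pert y t j) ≠ dist (pert y t i) (pert y t k)) ∧
      interactionEnergy lennardJones (pert y t) < interactionEnergy lennardJones y + ε := by
  have hev : ∀ᶠ t in nhds (0 : ℝ),
      interactionEnergy lennardJones (pert y t) < interactionEnergy lennardJones y + ε :=
    (tendsto_energy_pert y hy).eventually (gt_mem_nhds (lt_add_of_pos_right _ hε))
  obtain ⟨r, hr, hball⟩ := Metric.eventually_nhds_iff.1 hev
  set B : Set ℝ :=
    (⋃ i : Fin N, ⋃ j : Fin N, ⋃ k : Fin N, {t : ℝ | j ≠ i ∧ k ≠ i ∧ j ≠ k ∧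
      dist (pert y t i) (pert y t j) = dist (pert y t i) (pert y t k)}) ∪
    ⋃ i : Fin N, ⋃ j : Fin N, {t : ℝ | i ≠ j ∧ pert y t i = pert y t j} with hB_def
  have hB : B.Finite :=
    (Set.finite_iUnion fun i => Set.finite_iUnion fun j => Set.finite_iUnion fun k =>
      finite_bad_triple y i j k).union
      (Set.finite_iUnion fun i => Set.finite_iUnion fun j => finite_bad_pair y i j)
  obtain ⟨t, ht, htB⟩ := ((Set.Ioo_infinite hr).sdiff hB).nonempty
  refine ⟨t, ?_, ?_, hball ?_⟩
  · intro i j hij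
    by_contra hne
    exact htB (Or.inr (Set.mem_iUnion.2 ⟨i, Set.mem_iUnion.2 ⟨j, hne, hij⟩⟩))
  · intro i j k hj hk hjk heq
    exact htB (Or.inl (Set.mem_iUnion.2 ⟨i, Set.mem_iUnion.2 ⟨j, Set.mem_iUnion.2
      ⟨k, hj, hk, hjk, heq⟩⟩⟩))
  · rw [Real.dist_eq, sub_zero, abs_of_pos ht.1]
    exact ht.2

variable {y}

/-- At tolerance `η = 0` a configuration with pairwise distinct distances from each site is
FULLY charged: a bond at `i` has length exactly `nn_i`, so there is at most one. -/
theorem charged_eq_of_distinct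
    (h : ∀ i j k : Fin N, j ≠ i → k ≠ i → j ≠ k → dist (y i) (y j) ≠ dist (y i) (y k)) :
    charged 0 y = N := by
  unfold charged
  have hall : ∀ i : Fin N, ¬ IsChargeFree 0 y i := fun i hcf => by
    have h12 := hcf.1
    obtain ⟨j, k, hj, hk, hjk⟩ := (Set.one_lt_ncard_iff hcf.finite_neighborSet).1
      (by rw [h12]; norm_num)
    rw [mem_neighborSet_bondGraph] at hj hk
    have e1 : dist (y i) (y j) = nearestDist y i :=
      le_antisymm (hj.2.trans (by rw [add_zero, one_mul]; exact min_le_left _ _))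
        (nearestDist_le_dist y hj.1.symm)
    have e2 : dist (y i) (y k) = nearestDist y i :=
      le_antisymm (hk.2.trans (by rw [add_zero, one_mul]; exact min_le_left _ _))
        (nearestDist_le_dist y hk.1.symm)
    exact h i j k hj.1.symm hk.1.symm hjk (e1.trans e2.symm)
  rw [Nat.card_congr (Equiv.subtypeUnivEquiv hall), Nat.card_eq_fintype_card, Fintype.card_fin]

/-- **`η = 0` kills the gap** (given `TrialStates`): perturb a near-optimal trial state
generically; it becomes fully charged at energy cost `→ 0`. So any proof must use `η > 0`
quantitatively (the crux fixes `η = 1/100`). -/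
theorem not_gapWith_eta_zero
    (hTS : ∀ δ : ℝ, 0 < δ → ∃ (N : ℕ) (y : Fin N → E3), 0 < N ∧ Function.Injective y ∧
      interactionEnergy lennardJones y < (N : ℝ) * (eStar + δ))
    {κ : ℝ} (hκ : 0 < κ) (C : ℝ) : ¬ GapWith 0 κ C := by
  intro h
  have hnb := noBoundary_of_gapWith (by norm_num) h
  obtain ⟨N, y, hN, hy, hlt⟩ := hTS (κ / 2) (half_pos hκ)
  have hNr : (0 : ℝ) < N := by exact_mod_cast hN
  obtain ⟨t, hinj, hdist, hE⟩ := exists_pert y hy (ε := (N : ℝ) * (κ / 2)) (by positivity)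
  have := hnb N (pert y t) hinj
  rw [charged_eq_of_distinct hdist] at this
  linarith

/-- The same for the crux's literal shape at `η = 0` and at `η < 0`, from the route's own
support item `CrysEnergyUpper`. -/
theorem not_gapWith_of_eta_nonpos (hUB : CrysEnergyUpper) {η κ : ℝ} (hη : η ≤ 0) (hκ : 0 < κ)
    (C : ℝ) : ¬ GapWith η κ C := by
  rcases hη.lt_or_eq with hη | rfl
  · exact not_gapWith_of_eta_neg (trialStates_of_crysEnergyUpper hUB) hη hκ C
  · exact not_gapWith_eta_zero (trialStates_of_crysEnergyUpper hUB) hκ C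

end Tolerance

/-! ## §8. The periodic form of the pricing implies the crux

`PeriodicPricing η κ`: for EVERY periodic configuration `Q`, `κ·#(charged motif sites, charge read
in the infinite point set Q.points) ≤ #motif · (e(Q) − e*)`.  This implies `NoBoundary η κ`
(hence, at `η = 1/100` with `κ > 0`, the crux): periodise `y` with the LARGE period
`L(y) = 8D + 8`; the bond graph of the periodic point set restricted to the motif is the bond
graph of `y` (images are farther than twice any nearest-neighbour distance), so the charged motif
sites are exactly the charged sites of `y`, while `e(Q) ≤ E(y)/N`.  No `BddBelow` is needed in
this direction.  (The converse, crux ⇒ periodic form, needs block trial states — item 11865-type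
content — and is not attempted here.) -/

section PeriodicForm

variable {N : ℕ}

/-- Number of charged motif sites of a periodic configuration, charge being read in the infinite
point set `Q.points` (index type `Q.points`, configuration `Subtype.val`). -/
def motifCharged (η : ℝ) (Q : PeriodicConfiguration 3) : ℕ :=
  Nat.card {x : Q.motif //
    ¬ IsChargeFree η (Subtype.val : Q.points → E3) ⟨x.1, Q.mem_points_of_mem_motif x.2⟩}

/-- **Periodic pricing**: every periodic configuration pays `κ` per charged motif site above `e*`. -/
def PeriodicPricing (η κ : ℝ) : Prop :=
  ∀ Q : PeriodicConfiguration 3,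
    κ * (motifCharged η Q : ℝ) ≤ (Q.motif.card : ℝ) * (Q.energyPerParticle lennardJones - eStar)

/-- The large period `L(y) = 8D + 8` as a unit. -/
def spacingUnit (y : Fin N → E3) : ℝˣ :=
  Units.mk0 (spacing y) (by have := one_le_spacing_sub y; linarith [Dsum_nonneg y])

/-- Its value. -/
@[simp] theorem val_spacingUnit (y : Fin N → E3) : (spacingUnit y : ℝ) = spacing y := rfl

/-- `2D + 2 ≤ 8D + 8`. -/
theorem period_le_spacing (y : Fin N → E3) : period y ≤ (spacingUnit y : ℝ) := by
  rw [val_spacingUnit]; unfold period spacing; linarith [Dsum_nonneg y]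

/-- The far periodisation `y + (8D+8)ℤ³`. -/
def periodiseFar (y : Fin N → E3) (hN : 0 < N) : PeriodicConfiguration 3 :=
  periodise y (spacingUnit y) (period_le_spacing y) hN

/-- The motif of the far periodisation is `{yᵢ}`. -/
theorem motif_periodiseFar (y : Fin N → E3) (hN : 0 < N) :
    (periodiseFar y hN).motif = Finset.univ.image y := rfl

/-- The motif points of the far periodisation, as points of it. -/
def toPoint (y : Fin N → E3) (hN : 0 < N) (i : Fin N) : (periodiseFar y hN).points :=
  ⟨y i, (periodiseFar y hN).mem_points_of_mem_motif (by
    rw [motif_periodiseFar]; exact Finset.mem_image_of_mem y (Finset.mem_univ i))⟩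

/-- Its value. -/
@[simp] theorem val_toPoint (y : Fin N → E3) (hN : 0 < N) (i : Fin N) :
    ((toPoint y hN i : (periodiseFar y hN).points) : E3) = y i := rfl

/-- `toPoint` is injective for injective `y`. -/
theorem toPoint_injective {y : Fin N → E3} (hy : Function.Injective y) (hN : 0 < N) :
    Function.Injective (toPoint y hN) := fun _ _ h => hy (congrArg Subtype.val h)

/-- Dichotomy for points of the far periodisation: a motif point `yⱼ`, or far from every `yᵢ`
(distance `≥ 6D + 8`). -/
theorem eq_toPoint_or_far {y : Fin N → E3} (hN : 0 < N) (p : (periodiseFar y hN).points) :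
    (∃ j, p = toPoint y hN j) ∨ ∀ i, 6 * Dsum y + 8 ≤ dist (y i) p := by
  by_cases h : ∃ j, (p : E3) = y j
  · obtain ⟨j, hj⟩ := h
    exact Or.inl ⟨j, Subtype.ext hj⟩
  · push Not at h
    refine Or.inr fun i => ?_
    have := sub_le_dist_of_mem_points y (spacingUnit y) (period_le_spacing y) hN i p.2 h
    rw [val_spacingUnit] at this
    unfold spacing at this
    linarith

/-- Nearest-neighbour distances of motif points, read in the periodic point set, are those of
`y` (`y` injective, `N ≥ 2`). -/
theorem nearestDist_toPoint {y : Fin N → E3} (hy : Function.Injective y) (hN : 0 < N)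
    {i : Fin N} (hi : ∃ j, j ≠ i) :
    nearestDist (Subtype.val : (periodiseFar y hN).points → E3) (toPoint y hN i) =
      nearestDist y i := by
  obtain ⟨j₀, hj₀, hnn⟩ := exists_nearestDist_eq_dist y hi
  have hne0 : toPoint y hN j₀ ≠ toPoint y hN i := fun h => hj₀ (toPoint_injective hy hN h)
  apply le_antisymm
  · calc nearestDist (Subtype.val : (periodiseFar y hN).points → E3) (toPoint y hN i)
        ≤ dist ((toPoint y hN i : (periodiseFar y hN).points) : E3) (toPoint y hN j₀) :=
          nearestDist_le_dist _ hne0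
      _ = nearestDist y i := by simp [hnn]
  · refine le_nearestDist ⟨toPoint y hN j₀, hne0⟩ fun q hq => ?_
    rcases eq_toPoint_or_far hN q with ⟨j, rfl⟩ | hfar
    · have hji : j ≠ i := fun h => hq (by rw [h])
      simpa using nearestDist_le_dist y hji
    · calc nearestDist y i ≤ 2 * Dsum y := nearestDist_le_two_Dsum y hj₀
        _ ≤ 6 * Dsum y + 8 := by linarith [Dsum_nonneg y]
        _ ≤ dist (y i) q := hfar i

/-- Bonds at motif points of the far periodisation are exactly the bonds of `y` (`η ≤ 1`). -/
theorem adj_toPoint_iff {y : Fin N → E3} (hy : Function.Injective y) (hN : 0 < N) {η : ℝ}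
    (hη1 : η ≤ 1) (hN2 : ∀ i : Fin N, ∃ j, j ≠ i) (i : Fin N) (q : (periodiseFar y hN).points) :
    (bondGraph η (Subtype.val : (periodiseFar y hN).points → E3)).Adj (toPoint y hN i) q ↔
      ∃ j, q = toPoint y hN j ∧ (bondGraph η y).Adj i j := by
  constructor
  · intro h
    obtain ⟨hne, hle⟩ := bondGraph_adj.1 h
    rw [nearestDist_toPoint hy hN (hN2 i)] at hle
    rcases eq_toPoint_or_far hN q with ⟨j, rfl⟩ | hfar
    · refine ⟨j, rfl, bondGraph_adj.2 ⟨fun h' => hne (by rw [h']), ?_⟩⟩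
      rw [nearestDist_toPoint hy hN (hN2 j)] at hle
      simpa using hle
    · exfalso
      obtain ⟨j₀, hj₀⟩ := hN2 i
      have hnn : nearestDist y i ≤ 2 * Dsum y := nearestDist_le_two_Dsum y hj₀
      have hmin : min (nearestDist y i)
          (nearestDist (Subtype.val : (periodiseFar y hN).points → E3) q) ≤ 2 * Dsum y :=
        (min_le_left _ _).trans hnn
      have h1 : (1 + η) * min (nearestDist y i)
          (nearestDist (Subtype.val : (periodiseFar y hN).points → E3) q) ≤ 2 * (2 * Dsum y) :=
        mul_le_mul (by linarith) hmin (le_min (nearestDist_nonneg _ _) (nearestDist_nonneg _ _))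
          (by norm_num)
      have h2 := hfar i
      simp only [val_toPoint] at hle
      linarith [Dsum_nonneg y]
  · rintro ⟨j, rfl, hadj⟩
    obtain ⟨hne, hle⟩ := bondGraph_adj.1 hadj
    refine bondGraph_adj.2 ⟨fun h => hne (toPoint_injective hy hN h), ?_⟩
    rw [nearestDist_toPoint hy hN (hN2 i), nearestDist_toPoint hy hN (hN2 j)]
    simpa using hle

/-- Neighbour sets of motif points are the images of the neighbour sets of `y`. -/
theorem neighborSet_toPoint {y : Fin N → E3} (hy : Function.Injective y) (hN : 0 < N) {η : ℝ}
    (hη1 : η ≤ 1) (hN2 : ∀ i : Fin N, ∃ j, j ≠ i) (i : Fin N) :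
    (bondGraph η (Subtype.val : (periodiseFar y hN).points → E3)).neighborSet (toPoint y hN i) =
      toPoint y hN '' (bondGraph η y).neighborSet i := by
  ext q
  rw [SimpleGraph.mem_neighborSet, adj_toPoint_iff hy hN hη1 hN2, Set.mem_image]
  constructor
  · rintro ⟨j, rfl, hadj⟩; exact ⟨j, hadj, rfl⟩
  · rintro ⟨j, hadj, rfl⟩; exact ⟨j, rfl, hadj⟩

/-- Ring numbers along bonds of motif points are those of `y`. -/
theorem ringNumber_toPoint {y : Fin N → E3} (hy : Function.Injective y) (hN : 0 < N) {η : ℝ}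
    (hη1 : η ≤ 1) (hN2 : ∀ i : Fin N, ∃ j, j ≠ i) (i j : Fin N) :
    ringNumber η (Subtype.val : (periodiseFar y hN).points → E3) (toPoint y hN i)
      (toPoint y hN j) = ringNumber η y i j := by
  rw [ringNumber_def, ringNumber_def, neighborSet_toPoint hy hN hη1 hN2,
    neighborSet_toPoint hy hN hη1 hN2, ← Set.image_inter (toPoint_injective hy hN),
    Set.ncard_image_of_injective _ (toPoint_injective hy hN)]

/-- **Charge of motif points read in the periodic point set = charge in `y`.** -/
theorem isChargeFree_toPoint_iff {y : Fin N → E3} (hy : Function.Injective y) (hN : 0 < N)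
    {η : ℝ} (hη1 : η ≤ 1) (hN2 : ∀ i : Fin N, ∃ j, j ≠ i) (i : Fin N) :
    IsChargeFree η (Subtype.val : (periodiseFar y hN).points → E3) (toPoint y hN i) ↔
      IsChargeFree η y i := by
  rw [isChargeFree_iff, isChargeFree_iff, neighborSet_toPoint hy hN hη1 hN2,
    Set.ncard_image_of_injective _ (toPoint_injective hy hN), Set.forall_mem_image]
  refine and_congr_right fun _ => forall₂_congr fun j _ => ?_
  rw [ringNumber_toPoint hy hN hη1 hN2]

/-- The `yᵢ` are motif points of the far periodisation. -/
theorem mem_motif_periodiseFar (y : Fin N → E3) (hN : 0 < N) (i : Fin N) :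
    y i ∈ (periodiseFar y hN).motif := by
  rw [motif_periodiseFar]; exact Finset.mem_image_of_mem y (Finset.mem_univ i)

/-- Hence the far periodisation has exactly `#charged(y)` charged motif sites. -/
theorem motifCharged_periodiseFar {y : Fin N → E3} (hy : Function.Injective y) (hN : 0 < N)
    {η : ℝ} (hη1 : η ≤ 1) (hN2 : ∀ i : Fin N, ∃ j, j ≠ i) :
    motifCharged η (periodiseFar y hN) = charged η y := by
  unfold motifCharged charged
  let f : {i : Fin N // ¬ IsChargeFree η y i} →
      {x : (periodiseFar y hN).motif //
        ¬ IsChargeFree η (Subtype.val : (periodiseFar y hN).points → E3)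
          ⟨x.1, (periodiseFar y hN).mem_points_of_mem_motif x.2⟩} :=
    fun i => ⟨⟨y i.1, mem_motif_periodiseFar y hN i.1⟩, by
      have h := i.2
      rw [← isChargeFree_toPoint_iff hy hN hη1 hN2] at h
      exact h⟩
  have hf : Function.Bijective f := by
    constructor
    · intro a b hab
      have : y a.1 = y b.1 := congrArg (fun z => ((z.1 : (periodiseFar y hN).motif) : E3)) hab
      exact Subtype.ext (hy this)
    · rintro ⟨⟨v, hv⟩, hc⟩
      have hv' := hv
      rw [motif_periodiseFar] at hv'
      obtain ⟨i, -, rfl⟩ := Finset.mem_image.1 hv'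
      refine ⟨⟨i, ?_⟩, rfl⟩
      rw [← isChargeFree_toPoint_iff hy hN hη1 hN2]
      exact hc
  exact (Nat.card_congr (Equiv.ofBijective f hf)).symm

/-- **Periodic pricing implies the allowance-free gap** (`η ≤ 1`; no `BddBelow` needed). -/
theorem noBoundary_of_periodicPricing {η κ : ℝ} (hη1 : η ≤ 1) (h : PeriodicPricing η κ) :
    NoBoundary η κ := by
  have main : ∀ {N : ℕ}, 2 ≤ N → ∀ (y : Fin N → E3), Function.Injective y →
      (N : ℝ) * eStar + κ * (charged η y : ℝ) ≤ interactionEnergy lennardJones y := by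
    intro N hN y hy
    have hN0 : 0 < N := by omega
    have hN2 : ∀ i : Fin N, ∃ j, j ≠ i := exists_ne_of_two_le hN
    have hp := h (periodiseFar y hN0)
    rw [motifCharged_periodiseFar hy hN0 hη1 hN2] at hp
    have hcard : (((periodiseFar y hN0).motif.card : ℕ) : ℝ) = N := by
      rw [motif_periodiseFar, Finset.card_image_of_injective _ hy, Finset.card_univ,
        Fintype.card_fin]
    rw [hcard] at hp
    have hNr : (0 : ℝ) < N := by exact_mod_cast hN0
    have he := energyPerParticle_periodise_le hy (spacingUnit y) (period_le_spacing y) hN0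
    rw [le_div_iff₀ hNr, mul_comm] at he
    have he' : (N : ℝ) * (periodiseFar y hN0).energyPerParticle lennardJones ≤
        interactionEnergy lennardJones y := he
    nlinarith
  have hdimer : eStar + κ ≤ -1 / 24 := by
    have := main le_rfl dimer dimer_injective
    rw [charged_eq_of_le (by norm_num) dimer, interactionEnergy_dimer] at this
    push_cast at this
    linarith
  intro N y hy
  rcases Nat.lt_or_ge N 2 with hN | hN
  · interval_cases N
    · rw [charged_zero, interactionEnergy_of_subsingleton]
      simp
    · rw [charged_eq_of_le (by norm_num) y, interactionEnergy_of_subsingleton]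
      push_cast
      linarith
  · exact main hN y hy

/-- **`PeriodicPricing (1/100) κ` with `κ > 0` implies `ChargedEnergyGap`.** -/
theorem chargedEnergyGap_of_periodicPricing {κ : ℝ} (hκ : 0 < κ)
    (h : PeriodicPricing (1 / 100) κ) : ChargedEnergyGap :=
  chargedEnergyGap_iff_noBoundary.2 ⟨κ, hκ, noBoundary_of_periodicPricing (by norm_num) h⟩

end PeriodicForm

/-! ## §9. Cycle 3 (gen 3): one variational constant · the periodic side · blindness

Proved in the landed companions `Negative/PeriodicMinimisers.lean` (part VIII) and
`Negative/BarlowBlind.lean` (part IX); re-exported here against THIS file's `eStar`, `charged`,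
`GapWith`, `NoBoundary`, `motifCharged` (definitionally the landed ones: `eStar_eq_landed`,
`gapWith_iff_landed`, …), so that the work file exhibits the cycle-3 findings.  `N.` below is the
landed namespace `Summit.AtomisticToContinuum.Crystallization.Theorems.ChargedEnergyGapNegative`. -/

section CycleThree

open Summit.AtomisticToContinuum.Crystallization.Theorems

/-- This file's `e*` is the landed one. -/
theorem eStar_eq_landed : eStar = ChargedEnergyGapNegative.eStar := rfl

/-- This file's `GapWith` is the landed one. -/
theorem gapWith_iff_landed (η κ C : ℝ) : GapWith η κ C ↔ ChargedEnergyGapNegative.GapWith η κ C :=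
  Iff.rfl

/-- This file's `NoBoundary` is the landed one. -/
theorem noBoundary_iff_landed (η κ : ℝ) : NoBoundary η κ ↔ ChargedEnergyGapNegative.NoBoundary η κ :=
  Iff.rfl

/-- This file's `motifCharged` is the landed one. -/
theorem motifCharged_eq_landed (η : ℝ) (Q : PeriodicConfiguration 3) :
    motifCharged η Q = ChargedEnergyGapNegative.motifCharged η Q := rfl

/-! ### §9a. `κ_max`: the crux is the strict positivity of one number -/

/-- **`ChargedEnergyGap ↔ 0 < κ_max(1/100)`**, where
`κ_max(η) = ⨅ (E_LJ(y) − N·e*)/#charged_η(y)` over charged finite injective `y`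
(`N.kappaMax`). -/
theorem chargedEnergyGap_iff_kappaMax_pos :
    ChargedEnergyGap ↔ 0 < ChargedEnergyGapNegative.kappaMax (1 / 100) :=
  ChargedEnergyGapNegative.chargedEnergyGap_iff_kappaMax_pos

/-- The admissible prices are exactly the ray `(−∞, κ_max]`. -/
theorem noBoundary_iff_le_kappaMax (η κ : ℝ) :
    NoBoundary η κ ↔ κ ≤ ChargedEnergyGapNegative.kappaMax η :=
  ChargedEnergyGapNegative.noBoundary_iff_le_kappaMax η κ

/-- **`GapWith η (κ_max η) 0` holds UNCONDITIONALLY** — all content of the crux is `κ_max > 0`. -/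
theorem gapWith_kappaMax (η : ℝ) : GapWith η (ChargedEnergyGapNegative.kappaMax η) 0 :=
  ChargedEnergyGapNegative.gapWith_kappaMax η

/-- Every charged configuration is a certified ceiling: `κ_max ≤ (E_LJ(y) − N·e*)/#charged(y)`
(numerically `≲ 3.4·10⁻⁵` at `η = 1/100`, §7; certified only symbolically, e.g. the dimer
`κ_max ≤ −1/24 − e*`, for want of a lower bound on `e*`). -/
theorem kappaMax_le_ratio {η : ℝ} {N : ℕ} {y : Fin N → E3} (hy : Function.Injective y)
    (hc : 0 < charged η y) :
    ChargedEnergyGapNegative.kappaMax η ≤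
      (interactionEnergy lennardJones y - (N : ℝ) * eStar) / (charged η y : ℝ) :=
  ChargedEnergyGapNegative.kappaMax_le_ratio hy hc

/-- **`κ_max(η) = 0` for every `η ≤ 0`** (part VI in the language of part VIII: at `η ≤ 0` the
priced gap fails for every `κ > 0`, while `GapWith η (κ_max η) 0` always holds).  The crux asserts
`κ_max(1/100) > 0`; numerically `κ_max(η)` stays `0` up to the bond-length split of the relaxed hcp
shell (`≈ 10⁻⁴`, granted hcp optimality) and follows the threshold law `≈ 0.4·η²` above it (§7). -/
theorem kappaMax_eq_zero_of_nonpos {η : ℝ} (hη : η ≤ 0) :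
    ChargedEnergyGapNegative.kappaMax η = 0 := by
  refine le_antisymm ?_ (ChargedEnergyGapNegative.kappaMax_nonneg η)
  by_contra hpos
  push Not at hpos
  exact ChargedEnergyGapNegative.not_gapWith_of_eta_nonpos' hη hpos 0
    (ChargedEnergyGapNegative.gapWith_kappaMax η)

/-! ### §9b. What the crux forces on periodic configurations; kill criteria -/

/-- Under the crux the charged fraction of EVERY periodic configuration is controlled by its
excess energy per particle. -/
theorem chargedFraction_le (h : ChargedEnergyGap) :
    ∃ κ : ℝ, 0 < κ ∧ ∀ Q : PeriodicConfiguration 3,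
      ChargedEnergyGapNegative.chargedFraction (1 / 100) Q ≤
        (Q.energyPerParticle lennardJones - eStar) / κ :=
  ChargedEnergyGapNegative.chargedFraction_le_of_chargedEnergyGap h

/-- **Under the crux a periodic Lennard-Jones ground state is charge-free at every point** (the
`P` of `HasPeriodicGroundStateEnergy lennardJones 3`, conjunct (i) of `Crystallization`). -/
theorem isChargeFree_of_isLeast (h : ChargedEnergyGap) {P : PeriodicConfiguration 3}
    (hP : IsLeast (Set.range fun Q : PeriodicConfiguration 3 => Q.energyPerParticle lennardJones)
      (P.energyPerParticle lennardJones)) (p : P.points) :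
    IsChargeFree (1 / 100) (Subtype.val : P.points → E3) p :=
  ChargedEnergyGapNegative.isChargeFree_of_isLeast h hP p

/-- **Under the crux the fully charged periodic class is uniformly gapped**: every periodic
configuration all of whose points are charged has `e(Q) ≥ e* + κ`. -/
theorem forall_charged_gapped (h : ChargedEnergyGap) :
    ∃ κ : ℝ, 0 < κ ∧ ∀ Q : PeriodicConfiguration 3,
      (∀ p : Q.points, ¬ IsChargeFree (1 / 100) (Subtype.val : Q.points → E3) p) →
        eStar + κ ≤ Q.energyPerParticle lennardJones := by
  obtain ⟨κ, hκ, hP⟩ := ChargedEnergyGapNegative.chargedEnergyGap_iff_periodicPricing.1 h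
  exact ⟨κ, hκ, fun Q hQ => ChargedEnergyGapNegative.le_energyPerParticle_of_forall_charged hP hQ⟩

/-- **Minimising sequences have charged fraction `→ 0`** (periodic twin of `ZeroChargeBulk`). -/
theorem tendsto_chargedFraction (h : ChargedEnergyGap) {Q : ℕ → PeriodicConfiguration 3}
    (hQ : Filter.Tendsto (fun n => (Q n).energyPerParticle lennardJones) Filter.atTop
      (nhds eStar)) :
    Filter.Tendsto (fun n => ChargedEnergyGapNegative.chargedFraction (1 / 100) (Q n))
      Filter.atTop (nhds 0) :=
  ChargedEnergyGapNegative.tendsto_chargedFraction_of_chargedEnergyGap h hQ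

/-- **Kill criterion 1.** One periodic ground state with one charged point refutes the crux. -/
theorem kill_charged_minimiser {Q : PeriodicConfiguration 3}
    (hQ : Q.energyPerParticle lennardJones = eStar)
    (hp : ∃ p : Q.points, ¬ IsChargeFree (1 / 100) (Subtype.val : Q.points → E3) p) :
    ¬ ChargedEnergyGap :=
  ChargedEnergyGapNegative.not_chargedEnergyGap_of_charged_minimiser hQ hp

/-- **Kill criterion 2.** Periodic configurations paying `< κ` per charged motif site, for every
`κ > 0`, refute the crux. -/
theorem kill_cheap_periodic_charge
    (h : ∀ κ : ℝ, 0 < κ → ∃ Q : PeriodicConfiguration 3,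
      (Q.motif.card : ℝ) * (Q.energyPerParticle lennardJones - eStar) < κ * (motifCharged (1 / 100) Q : ℝ)) :
    ¬ ChargedEnergyGap :=
  ChargedEnergyGapNegative.not_chargedEnergyGap_of_cheap_periodic_charge h

/-- **Kill criterion 3.** Fully charged periodic configurations with `e(Q_n) → e*` refute the
crux. -/
theorem kill_forall_charged_near
    (h : ∀ ε : ℝ, 0 < ε → ∃ Q : PeriodicConfiguration 3,
      (∀ p : Q.points, ¬ IsChargeFree (1 / 100) (Subtype.val : Q.points → E3) p) ∧
        Q.energyPerParticle lennardJones < eStar + ε) :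
    ¬ ChargedEnergyGap :=
  ChargedEnergyGapNegative.not_chargedEnergyGap_of_forall_charged_near h

/-! ### §9c. Blindness: the pricing is vacuous on the whole ideal Barlow family -/

/-- **Every point of every ideal close-packed Barlow stacking is charge-free** at every tolerance
`0 ≤ η`, `1 + η < √2` — any Hägg sequence (stacking word), any scale `a > 0`. -/
theorem isChargeFree_barlowStacking {a h : ℝ} {s : ℤ → ℤ} (hs : IsHaggSeq s) (ha : 0 < a)
    (hh : h ^ 2 = 2 / 3 * a ^ 2) {η : ℝ} (hη0 : 0 ≤ η) (hη : 1 + η < Real.sqrt 2)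
    (p : barlowStacking a h s) :
    IsChargeFree η (Subtype.val : barlowStacking a h s → E3) p :=
  ChargedEnergyGapNegative.Barlow.isChargeFree_barlowStacking hs ha hh hη0 hη p

/-- **`IsChargeFree (1/100)` is inhabited in `ℝ³`** (on an infinite point set): the target
`ZeroChargeBulk` and the crux are not false for want of charge-free sites. -/
theorem exists_isChargeFree :
    ∃ (S : Set E3) (p : S), S.Infinite ∧ IsChargeFree (1 / 100) (Subtype.val : S → E3) p :=
  ChargedEnergyGapNegative.Barlow.exists_isChargeFree

/-- **No charge anywhere in the hcp and fcc periodic configurations** (ideal spacing, any scale):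
the periodic pricing — hence the crux — is silent on hcp versus fcc and on the density. -/
theorem motifCharged_hcp_fcc_eq_zero {a h : ℝ} (ha : 0 < a) (hh : h ^ 2 = 2 / 3 * a ^ 2)
    (hh0 : h ≠ 0) :
    motifCharged (1 / 100) (hcpPeriodicConfiguration (a := a) (h := h) ha.ne' hh0) = 0 ∧
      motifCharged (1 / 100) (fccPeriodicConfiguration (a := a) (h := h) ha.ne' hh0) = 0 :=
  ChargedEnergyGapNegative.motifCharged_hcp_fcc_eq_zero ha hh hh0

/-- … and more generally for the periodic configuration of EVERY periodic Hägg sequence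
(`N.idealBarlowQ`), at every `0 ≤ η < √2 − 1`: `PeriodicPricing η κ` holds there for every `κ`. -/
theorem periodicPricing_at_idealBarlowQ {a h : ℝ} {s : ℤ → ℤ} {p : ℕ} (hs : IsHaggSeq s)
    (ha : 0 < a) (hh : h ^ 2 = 2 / 3 * a ^ 2) (hp : p ≠ 0) (hper : ∀ i, s (i + p) = s i)
    {η : ℝ} (hη0 : 0 ≤ η) (hη : 1 + η < Real.sqrt 2) (κ : ℝ) :
    κ * (motifCharged η (ChargedEnergyGapNegative.idealBarlowQ ha hh hp hper) : ℝ) ≤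
      ((ChargedEnergyGapNegative.idealBarlowQ ha hh hp hper).motif.card : ℝ) *
        ((ChargedEnergyGapNegative.idealBarlowQ ha hh hp hper).energyPerParticle lennardJones -
          eStar) :=
  ChargedEnergyGapNegative.periodicPricing_at_idealBarlowQ hs ha hh hp hper hη0 hη κ

end CycleThree

/-! ## §7. Numerics ledger (not Lean; cycles 2–3) — forced upper bounds on `κ`

Units: `V = r⁻¹²/12 − r⁻⁶/6`, Blanc–Lewin.  By §3–§4, an admissible `κ` satisfies
`κ ≤ (E(y) − N·e*)/#charged(y)` for EVERY injective `y`; a large crystallite of the optimal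
stacking carrying a fixed small density of copies of a local defect realises, in the limit,
`κ ≤ ΔE_defect / #(sites the defect charges)` (surface terms are `O(N^(2/3))` on both sides).
Granted `e* = e(hcp)`.

Lattice sums (this seat, `kit/kappa2_lite.py`, pure python, one-centre sums to `7.4 a` + continuum
tail): fcc `a* = 0.97123`, `e = −0.717521`; hcp `a = 0.97128`, `c/a = 1.63276` (deviation
`−1.4·10⁻⁴` from ideal, bond split `≈ 10⁻⁴ ≪ 1 %`), `e = −0.717592 ≈ e*`; interior sites of both
hosts are charge-free at `η = 1/100` (0 charged among the 250 interior sites of a 1507-atom hcp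
ball and of the fcc ball) — consistent with g1 (`−0.717590`) and crux-ideator-2 (`−0.717588`).

Cheapest charge carriers found (CLAMPED displacements, environment unrelaxed — valid upper
bounds; relaxation only lowers them; `ΔE`, `#charged`, price = `ΔE/#charged`):
* symmetric pinch of one bond by 0.80 % of `a` (fcc, and hcp in-plane/out-of-plane):
  `ΔE = 7.69·10⁻⁴`, 20 charged (the two ends lose their antipodal and 60°-bonds: `b = 7`; their
  ex-neighbours `b = 11`; common neighbours lose ring number 4), **price `3.85·10⁻⁵`**
  (g1 relaxed: `3.4·10⁻⁵`; ideator-2 unrelaxed `4.1·10⁻⁵`).  Onset of charge at pinch 0.70 %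
  (12 charged, `4.9·10⁻⁵`); asymmetric pinches and a 3-atom collinear grid search
  (`kit/kappa2_lite2.py`, 644 charged configurations) do not beat the symmetric pinch.
* two parallel pinches `2a` apart: 38 charged for `1.73·10⁻³` → `4.6·10⁻⁵` (no synergy).
* one atom pushed 0.70 % along a bond: 12 charged, `7.6·10⁻⁵`; 0.50 %: 6 charged, `7.8·10⁻⁵`.
* symmetric stretch 0.70 %: 6 charged, `9.6·10⁻⁵`.
* jitterbug-like twist of the two shell halves by 0.8°: 45 charged for `6.2·10⁻³` → `1.4·10⁻⁴`;
  shell breathing ±0.5 %: `2.4–2.8·10⁻⁴`.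
* (g1 / ideator-2) homogeneous threshold strains `≥ 1.5·10⁻⁴` (hcp basal shear 0.53 %), slip
  `≈ 10⁻⁴`, vacancy `0.12`, (111) surface `0.17`, monolayer `0.44`, isolated atom `0.72 = −e*`
  (§3 is its Lean form), bcc `3.1·10⁻²`, sc `0.24`, A15/C15 site types `≥ 2.2·10⁻²`
  (the `min(nn)` rule deletes every bond with > 1 % dispersion: FK sites have `b = 0–2`).
KILL CHECK: no configuration with charged sites at `ΔE ≤ 0` in any scan (0 of ~900 rows).
Pending kit jobs (farm saturated at submission): j006570 / j006942 (`kit/kappa2.py`,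
`kit/kappa2b.py`: numpy versions with more families and L-BFGS relaxation) — results to be folded
in by the next cycle.

CONSEQUENCES for provers.  (i) The admissible price is `κ ≲ 3·10⁻⁵ ≈ 4·10⁻⁵·|e*|`, two orders
below the card's "`κ_q ≈ 2.6·10⁻³` per missing square": the unit of charge is not a missing
contact but a 1 %-threshold crossing, bought by a 0.4 % displacement of two atoms and spread over
≈ 20 charged sites by the ring-number bookkeeping.  Any certified price list (TruncatedCensusGap)
must therefore price at the `10⁻⁵` scale.  (ii) One-centre pricing is false at first order (a site
can be charged by its neighbours' moves at zero own cost; site energies of √2-neighbours move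
linearly), so the localisation functional needs the null-Lagrangian corrections the route already
foresees.  (iii) Why no zero-cost charge: a charge needs a ≥ 1 % relative distortion inside some
link; one displaced atom is seen by ≤ 57 links (coordination sequences fcc 1, 12, 42; hcp 1, 12, 44) and costs
≥ `12·V''·δ²/2`-type harmonic energy with `δ ≥ 0.4 %`, giving a perturbative floor of order
`5·10⁻⁶`; below that only a non-Barlow periodic near-minimiser of `e_LJ` could go, and none is
known (Bétermin–Šamaj–Travěnec 2021, arXiv:2107.14020, §3.1 p. 8: among Bravais lattices + HCP
"only two lattices appear to be global minimizers … FCC and HCP"; p. 1: rigorous global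
minimality in `d = 3` is known only for perturbations of hard-sphere potentials).
(iv) A quantitative floor for the tolerance (numerics, complements §6): the equilibrium hcp shell
splits 6 + 6 with relative bond-length difference `≈ 9·10⁻⁵` (`c/a = 1.63276`), so for
`0 < η ≲ 10⁻⁴` the optimal stacking itself is fully charged (`b = 6`) at zero excess and
`GapWith η κ C` fails for every `κ > 0` (granted `e* = e(hcp)`); the admissible `κ(η)` rises
from `0` at `η ≈ 10⁻⁴` to `≈ 3·10⁻⁵` at `η = 1/100`.  The crux's `1/100` sits comfortably above
this floor and below the fcc/hcp second-shell ratio `√2 − 1`.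
-/

end Summit.AtomisticToContinuum.Crystallization.Cruxes.ChargedEnergyGap.Disproof

end
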